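import Literature.AlgebraicGeometry.Deligne1982.ExteriorPowerOverBaseChange
import Literature.Algebra.Lie.KillingBaseChange
import Mathlib.LinearAlgebra.PerfectPairing.Basic
import HarnessLib

/-!
# Milne's Remark 2.2 on Deligne's split-étale carrier: the weight spaces of an étale algebra with involution are
# paired by a Hermitian form, each pair `V_{L,s} × V_{L,ιs} → L` is a perfect duality, and restriction
# `α ↦ (α|V_{L,s})_{s ∈ Φ}` is an isomorphism `U(φ)(L) ≅ ∏_{s ∈ Φ} GL(V_{L,s})` whose inverse acts on the
# partners by the contragredient — Milne 1999 §2 Remark 2.2 (`[k′ : k] = 2`: "`α ↦ α|V₁ : U(φ)_Ω → GL(V₁)` is an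
# isomorphism") and its use for types II–IV (pp. 650–651: "`S_σ ≈ Aut_{M_d}(V₁) ≈ GL`", "standard ⊕ contragredient")

[topic AlgebraicGeometry/Deligne1982]

Layer `Literature/AlgebraicGeometry/Deligne1982`, lane `lit-hodgefound` (Track 2 foundations library; seat
`lit-hodgefound-p34`, generation 21, self-proposed row g21-#1 of `run/shared/lean/pub/lit-hodgefound/SKELETON.md`).
PURE LINEAR ALGEBRA on the carrier of `Deligne1982/ExteriorPowerOverBaseChange` (§2 there: a field `k`, a commutative
finite-dimensional `k`-algebra `k′ = K` with non-degenerate trace form, a field `L ⊇ k` SPLITTING `k′` through an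
injective family `σ : S → Hom_k(k′, L)` with `card S = [k′ : k]`, a `k′`-module `V`, the joint eigenspaces
`V_{L,s} = weightSpace k K L V σ s ⊆ L ⊗_k V` of the action `actL`, their projectors `weightProj` and
`L ⊗_k V = ⊕ₛ V_{L,s}`, `isInternal_weightSpace`). NEW data here: a `k`-algebra involution `† = star : k′ → k′`
(Milne's "nontrivial involution of `k′` fixing `k`"; complex conjugation of a CM field), the index involution
`ι : S → S` it induces on the weights (`σ_{ιs} = σₛ ∘ †`), and a `k`-bilinear form `ψ` on `V` which is HERMITIAN FOR `†`:
`ψ(a x, y) = ψ(x, a† y)` (Milne's `L`-valued skew-Hermitian `φ` is read through `e_D = Tr_{L/k} ∘ φ`: "an `L`-linear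
automorphism of `V(A)` fixes `φ` if and only if it fixes `e_D`", p. 646 — so `U(φ)` is the group of `k′ ⊗ L`-linear
automorphisms fixing `ψ_L`, which is what is DEFINED below; the transfer `φ` itself is the tree's
`Motives.traceTransfer` of `Motives/HodgeStructureLefschetzGroupTraceTransfer`, not needed here). THEOREMS plus eleven
definitions WITH BODIES (`weightPairing` = Milne's `φ₁`, `formUnitaryGroup` = `U(φ)(L)`, `restrictWeightSpace` /
`restrictHom` = `α ↦ α|V₁`, `weightDuality` = "`V₂ = V₁^∨`", `contragredient` = `g ↦ ᵗg⁻¹`, `weightProjCod`, `extend` /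
`extendEquiv` = the inverse of restriction, `formUnitaryGroupEquiv` / `formUnitaryGroupEquivOfPair` = the isomorphism);
no named fact (net debt `0`).

## The source, verbatim

J. S. Milne, *Lefschetz classes on abelian varieties*, Duke Math. J. **96** (1999) 639–675 [Milne1999LefschetzClasses]
(held `paper:doi-10-1215-s0012-7094-99-09620-5`; Duke page = folio + 638; line numbers of the held text).

* §2 p. 646 L28–L42 (p0008): "If `†` denotes the Rosati involution with respect to `D`, then `e_D(αx, y) = e_D(x, α†y)`,
  all `α ∈ E`, `x, y ∈ V(A)`. Let `L` be a semisimple `k`-subalgebra of `E ⊗_ℚ k` stable under `†`. There exists a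
  unique skew-Hermitian pairing of `L`-modules `φ : V(A) × V(A) → L` such that `Tr_{L/k} ∘ φ = e_D`. From the uniqueness
  of `φ`, one deduces that **an `L`-linear automorphism of `V(A)` fixes `φ` if and only if it fixes `e_D`**." and L55–L58:
  "Any `k`-linear map `α : V → V` commuting with the action of `F` decomposes into `α = α₁ ⊕ ⋯ ⊕ α_t`, `αᵢ : Vᵢ → Vᵢ`".
* **Remark 2.2** (p. 647 L48 – p. 648 L7; p0009/p0010): "Let `k` be a field, and let `k′` be an étale `k`-algebra of
  degree 2 (so that either `k′ = k × k` or `k′` is a field of degree 2 over `k`). Let `φ` be a nondegenerate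
  skew-Hermitian form on a `k′`-vector space `V` relative to the nontrivial involution of `k′` fixing `k`. Let `Ω` be a
  field containing `k` and large enough so that there exist distinct `k`-homomorphisms `σ₁, σ₂ : k′ → Ω`. Write
  `V ⊗_k Ω = V₁ ⊕ V₂`, `Vᵢ = V ⊗_{k′,σᵢ} Ω`, `i = 1, 2`. The form `φ` extends to an `Ω × Ω`-bilinear form on `V ⊗_k Ω`,
  which we again denote `φ`. Then **`φ|V₁ × V₁ = 0 = φ|V₂ × V₂`, and there is a nondegenerate `Ω`-bilinear form
  `φ₁ : V₁ × V₂ → Ω`** such that `φ((x₁, x₂), (y₁, y₂)) = (φ₁(x₁, y₂), −φ₁(x₂, y₁))` […]. **Therefore, the map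
  `α ↦ α|V₁ : U(φ)_Ω → GL(V₁)` is an isomorphism, and the representation of `U(φ)_Ω` on `V ⊗_k Ω` becomes the direct sum
  of the representation of `GL(V₁)` on `V₁` (standard representation) and the representation of `GL(V₁)` on `V₂`
  (contragredient of the standard representation).**"
* Its uses: p. 650 L33–L36 (p0012; types II/III) "(see 2.2) `γ ↦ γ|V_{σ₁}` identifies `U(φ_{1,σ}) ∩ Sp(φ_{2,σ})` with
  `Sp(φ_{2,σ₁})`. The representation of `Sp(φ_{2,σ₁})` on `V_{σ₁}` is its standard representation, and its representation
  on `V_{σ₂}` is the contragredient of the standard representation"; p. 650 L72 "Let `V₂ = V₁^∨`"; p. 651 L72–L81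
  (p0013; type IV) "`S(A)_{/k^al} = ∏ S_σ` where `S_σ ≈ Aut_{M_d(k^al)}(V₁) ≈ GL_{fg/d}(k^al)`. The representation of `S_σ`
  on `V_σ` is isomorphic to the direct sum of `d` copies of the standard representation of `GL_{fg/d}(k^al)` and `d` copies
  of its contragredient."; §1 p. 644 L18 (p0006) "`S(A)(R) = {γ ∈ C(A) ⊗_k R | γ†γ = 1}`".
* P. Deligne, *Hodge cycles on abelian varieties*, LNM 900 (1982) [Deligne1982HodgeCycles], §4 proof of Prop. 4.4
  (re-ed. p. 30: "`H¹_B(A) ⊗ ℂ ⥲ ⊕_{σ∈S} H¹_{B,σ}` … such that `e ∈ E` acts on `H¹_{B,σ}` as `σe`" — the carrier) and proof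
  of Lemma 4.6 ("the `φ`-orthogonal decomposition" of `H¹ ⊗ ℂ` for a CM field acting compatibly with a polarization).

## Dictionary and what is PROVED (hypotheses: `hψ` Hermitian, `hσ` injective, `hcard`, `hK` étale, `hι : σ (ι s) = σ s ∘ †`, `hstar : †† = 1`, `hnd : ψ` non-degenerate, `hε : ψ(y, x) = ε ψ(x, y)` where stated)

Milne's `Ω` ↦ `L`; `V₁, V₂` ↦ `V_{L,s}, V_{L,ιs}` (any `[k′ : k]`, the weights coming in `ι`-PAIRS; for `k′` quadratic
`S = {s₁, s₂ = ιs₁}`); "`φ` extended `Ω × Ω`-bilinearly" ↦ `ψ_L = LinearMap.BilinForm.baseChange L ψ`; `φ₁` ↦ DEF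
`weightPairing σ ι ψ s : V_{L,s} →ₗ V_{L,ιs} →ₗ L`; `U(φ)_Ω` (its `Ω`-points) ↦ DEF `formUnitaryGroup K L ψ` = `{γ ∈
GL_L(L ⊗_k V) | γ ∘ (a ⊗ L) = (a ⊗ L) ∘ γ ∀ a ∈ k′, ψ_L(γx, γy) = ψ_L(x, y)}`; `α|V₁` ↦ DEF `restrictHom ψ σ s : U(φ)(L) →*
GL(V_{L,s})`; "`V₂ = V₁^∨`" ↦ DEF `weightDuality … s : V_{L,ιs} ≃ₗ Dual V_{L,s}`; "contragredient of the standard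
representation" ↦ DEF `contragredient … s g = ᵗg⁻¹ ∈ GL(V_{L,ιs})`; a set of representatives `Φ ⊆ S` of the pairs
(`hΦ₁ : ∀ s, s ∈ Φ ∨ ι s ∈ Φ`, `hΦ₂ : ∀ s ∈ Φ, ι s ∉ Φ`; Milne: `Φ = {σ₁}`; Deligne/Milne type IV: a CM type).

* §1 **"`φ|V₁ × V₁ = 0 = φ|V₂ × V₂`"**: `baseChange_actL_left` (`ψ_L((a ⊗ L)x, y) = ψ_L(x, (a† ⊗ L)y)`),
  **`baseChange_apply_eq_zero_of_mem_weightSpace`** (`V_{L,s} ⊥ V_{L,t}` unless `σₛ = σₜ ∘ †`), `eq_comp_star_iff`, `ι_ι`,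
  `baseChange_apply_eq_zero_of_ne` (`⊥` unless `s = ι t`), **`baseChange_apply_eq_zero_of_mem_weightSpace_self`**
  (`ψ_L|V_{L,s} × V_{L,s} = 0` if `ι s ≠ s`); **"`φ((x₁,x₂),(y₁,y₂)) = (φ₁(x₁,y₂), −φ₁(x₂,y₁))`"**:
  `baseChange_apply_eq_apply_weightProj_of_mem_left/right`, `baseChange_apply_eq_sum_weightProj`
  (`ψ_L(x, y) = Σₛ ψ_L(πₛx, π_{ιs}y)`).
* §2 **"there is a nondegenerate `Ω`-bilinear form `φ₁ : V₁ × V₂ → Ω`"**: `weightPairing_injective`,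
  `weightPairing_flip_injective`, **`isPerfPair_weightPairing`**, and `finrank_weightSpace_eq_finrank_weightSpace_ι`
  (`dim V_{L,s} = dim V_{L,ιs}`).
* §3 **`U(φ)(L)`** (`formUnitaryGroup`, `mem_formUnitaryGroup_iff`), **"`α = α₁ ⊕ ⋯ ⊕ α_t`"** (`apply_mem_weightSpace_of_comm`,
  `map_weightSpace_eq_of_comm`, `restrictWeightSpace`, **`restrictHom`**), the **contragredient rule**
  `weightPairing_restrictHom_restrictHom` (`φ₁(γx, γy) = φ₁(x, y)`), and **INJECTIVITY of `α ↦ α|V₁`**: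
  `eqOn_weightSpace_ι_of_eqOn` (`γ|V_{L,s}` determines `γ|V_{L,ιs}`), `eq_of_eqOn_weightSpace`,
  `restrictHom_injective_of_cover`.
* §4 **"contragredient of the standard representation"**: `weightDuality`, **`contragredient`**,
  `weightPairing_apply_contragredient` (`φ₁(gx, ᵗg⁻¹y) = φ₁(x, y)`), `eq_contragredient_of_forall` (uniqueness),
  **`restrictHom_ι_eq_contragredient`** (`γ|V_{L,ιs} = ᵗ(γ|V_{L,s})⁻¹` for `γ ∈ U(φ)(L)`); the inverse construction
  **`extend` / `extendEquiv`** (`⊕_{s∈Φ} (g_s ⊕ ᵗg_s⁻¹)`) with `extend_apply_of_mem(_ι)`, `extend_apply_mem`, `extend_comm`,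
  `baseChange_extend_extend` (preserves `ψ_L`, for `ε`-symmetric `ψ`), `extend_injective`, **`extendEquiv_mem`**,
  `restrictHom_extendEquiv`; tools `weightProjCod`, `weightProj_apply_comm_of_comm`, `linearMap_eq_of_eqOn_weightSpace`.
* §5 **"the map `α ↦ α|V₁ : U(φ)_Ω → GL(V₁)` is an isomorphism"**: **`formUnitaryGroupEquiv … Φ : U(φ)(L) ≃* ∏_{s ∈ Φ}
  GL(V_{L,s})`** (`_apply`: it IS restriction), `exists_unique_restrictHom_eq`, and the printed quadratic case
  **`formUnitaryGroupEquivOfPair : U(φ)(L) ≃* GL(V_{L,s₁})`** for `S = {s₁, ιs₁}`, `ιs₁ ≠ s₁`.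

The `ε`-symmetry (`ε = −1`: Milne's skew-Hermitian `φ` / skew-symmetric `e_D`; `ε = (−1)ⁿ` for a polarization of
weight `n`) is used exactly once, to present a pair given as `(ιs₀, s₀)` with `s₀ ∈ Φ` in the order `(s₀, ιs₀)`; §1–§3
and the contragredient need no symmetry.

NOT here (said so as not to over-claim): the algebraic group `U(φ)` as a scheme / Weil restriction and non-split `L`
(only `L`-points for `L` splitting `k′`); Milne's `L`-valued `φ` itself (the tree's `Motives.traceTransfer`, BY NAME); the
existence of `σ` (a splitting field) and of `ι` (for `σ` bijective onto `Hom_k(k′, L)`, `ι` is `σ⁻¹(σ(·) ∘ †)`); types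
II/III (`U(φ₁) ∩ Sp(φ₂)`, `∩ O(φ₂)`: a SECOND form) and the division-algebra part `d > 1` of type IV (Remarks 2.3–2.4,
Morita); the transport to the abstract polarized `ℚ`-Hodge structure with `E_φ = ι(F)`, `F` a CM field
(`Motives/HodgeStructureLefschetzGroupEigenspaceSplitting`: `EndAction.eigenspaceBaseChange K A χ` IS
`Deligne1982.weightSpace` by its `weightSpace_eq_eigenspaceBaseChange`, and for `E_φ = ι(F)` the group `S(H)(K)` of
`Motives/HodgeStructureLefschetzGroupPoints` has the shape of this file's `formUnitaryGroup`) — a sequel.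
Related tree results on OTHER carriers, BY NAME: `Milne1999/SpecialLefschetzGroupInvariantsGLPowers` (`glBlockLin`,
"`g ↦ (g⁻¹)ᵀ`" on the Betti eigenbasis of a CM abelian variety, matrices), `Milne1999/LefschetzCentraliserCM`
(`S(A)(ℂ)` diagonal for CM), `Motives/HodgeStructureLefschetzGroupEigenspaceSplitting` §4–§5 (type I, `† = 1`:
`S(H)(K) ≅ ∏_σ Sp(V_{K,σ})` as injectivity + surjectivity), `Deligne1982/ExteriorPowerOverBaseChange` (the carrier).

## References

* [Milne1999LefschetzClasses] J. S. Milne, *Lefschetz classes on abelian varieties*, Duke Math. J. 96 (1999) 639–675,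
  §2 Remark 2.2 (pp. 647–648), pp. 646, 650–651, §1 p. 644.
* [Deligne1982HodgeCycles] P. Deligne, *Hodge cycles on abelian varieties*, in: Deligne–Milne–Ogus–Shih, LNM 900,
  Springer (1982), §4: proof of Prop. 4.4, proof of Lemma 4.6.
* [Varadarajan1984] V. S. Varadarajan, *Lie Groups, Lie Algebras, and Their Representations*, GTM 102 (1984), §3.9
  (3.9.17) — non-degeneracy under base change (the tree's `Algebra/Lie/KillingBaseChange`).
-/

noncomputable section

open scoped TensorProduct
open Function Module

namespace Literature.AlgebraicGeometry.Deligne1982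

universe uk uK uL uV uS

section Orthogonality

variable {k : Type uk} [Field k] {K : Type uK} [CommRing K] [Algebra k K]
variable {L : Type uL} [Field L] [Algebra k L]
variable {V : Type uV} [AddCommGroup V] [Module k V] [Module K V] [IsScalarTower k K V]
variable {S : Type uS} (σ : S → (K →ₐ[k] L))
variable (star : K →ₐ[k] K) (ι : S → S)
variable (ψ : LinearMap.BilinForm k V)

/-! ## §1 The involution: `ψ(ax, y) = ψ(x, a†y)`, its base change, and the pairing of the weight spaces -/

/-- **The (skew-)Hermitian condition survives base change**: if `ψ(a x, y) = ψ(x, a† y)` for all `a ∈ k′`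
(Milne: `φ(αx, βy) = α φ(x, y) β†` read through `e_D = Tr_{k′/k} ∘ φ`), then
`ψ_L((a ⊗ L) x, y) = ψ_L(x, (a† ⊗ L) y)` on `L ⊗_k V`.
[cite: Milne1999LefschetzClasses, §2 p. 646 L32 ("e_D(αx, y) = e_D(x, α†y), all α ∈ E") and Remark 2.2 p. 647 L48–L51] -/
theorem baseChange_actL_left (hψ : ∀ (a : K) (x y : V), ψ (a • x) y = ψ x (star a • y)) (a : K)
    (x y : L ⊗[k] V) :
    LinearMap.BilinForm.baseChange L ψ (actL k K L V a x) y =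
      LinearMap.BilinForm.baseChange L ψ x (actL k K L V (star a) y) := by
  induction x using TensorProduct.induction_on generalizing y with
  | zero => simp
  | add x₁ x₂ h₁ h₂ => simp only [map_add, LinearMap.add_apply, h₁, h₂]
  | tmul l v =>
    induction y using TensorProduct.induction_on with
    | zero => simp
    | add y₁ y₂ h₁ h₂ => simp only [map_add, h₁, h₂]
    | tmul l' v' =>
      rw [actL_tmul, actL_tmul, LinearMap.BilinForm.baseChange_tmul, LinearMap.BilinForm.baseChange_tmul, hψ]

/-- **Orthogonality of unpaired weight spaces**: for `x ∈ V_{L,s}`, `y ∈ V_{L,t}` with `σₛ ≠ σₜ ∘ †`,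
`ψ_L(x, y) = 0` — since `σₛ(a) ψ_L(x, y) = ψ_L(a x, y) = ψ_L(x, a† y) = σₜ(a†) ψ_L(x, y)` for all `a`.
(Milne, Remark 2.2: "`φ|V₁ × V₁ = 0 = φ|V₂ × V₂`"; Deligne, proof of Lemma 4.6: "the `φ`-orthogonal
decomposition".) [cite: Milne1999LefschetzClasses, §2 Remark 2.2 (p. 647 L48 – p. 648 L7)] [cite: Deligne1982HodgeCycles, §4 proof of Lemma 4.6] -/
theorem baseChange_apply_eq_zero_of_mem_weightSpace
    (hψ : ∀ (a : K) (x y : V), ψ (a • x) y = ψ x (star a • y)) {s t : S}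
    (hst : σ s ≠ (σ t).comp star) {x y : L ⊗[k] V}
    (hx : x ∈ weightSpace k K L V σ s) (hy : y ∈ weightSpace k K L V σ t) :
    LinearMap.BilinForm.baseChange L ψ x y = 0 := by
  by_contra hne
  apply hst
  refine AlgHom.ext fun a => ?_
  rw [mem_weightSpace_iff] at hx hy
  have h := baseChange_actL_left star ψ hψ a x y (L := L)
  rw [hx a, hy (star a), map_smul, LinearMap.smul_apply, map_smul, smul_eq_mul, smul_eq_mul] at h
  exact mul_right_cancel₀ hne h

/-- With an index involution `ι` matching `†` (`σ_{ι s} = σₛ ∘ †`) and an injective family `σ`: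
`σₛ = σₜ ∘ †` iff `s = ι t`. [cite: Milne1999LefschetzClasses, §2 Remark 2.2 (p. 647, "σ₁, σ₂ : k′ → Ω")] -/
theorem eq_comp_star_iff (hσ : Injective σ) (hι : ∀ s, σ (ι s) = (σ s).comp star) (s t : S) :
    σ s = (σ t).comp star ↔ s = ι t := by
  rw [← hι t]
  exact ⟨fun h => hσ h, fun h => by rw [h]⟩

/-- `ι` is an involution when `†` is (`σ_{ιιs} = σₛ ∘ † ∘ † = σₛ` and `σ` is injective).
[cite: Milne1999LefschetzClasses, §2 Remark 2.2 (p. 647, "the nontrivial involution of k′ fixing k")] -/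
theorem ι_ι (hσ : Injective σ) (hι : ∀ s, σ (ι s) = (σ s).comp star) (hstar : ∀ a, star (star a) = a)
    (s : S) : ι (ι s) = s := by
  apply hσ
  rw [hι, hι]
  refine AlgHom.ext fun a => ?_
  simp only [AlgHom.comp_apply, hstar]

/-- **`V_{L,s} ⊥ V_{L,t}` unless `s = ι t`** (indexed form of the orthogonality).
[cite: Milne1999LefschetzClasses, §2 Remark 2.2 (p. 647 L48 – p. 648 L7, "φ|V₁ × V₁ = 0 = φ|V₂ × V₂")] -/
theorem baseChange_apply_eq_zero_of_ne (hψ : ∀ (a : K) (x y : V), ψ (a • x) y = ψ x (star a • y))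
    (hσ : Injective σ) (hι : ∀ s, σ (ι s) = (σ s).comp star) {s t : S} (hst : s ≠ ι t)
    {x y : L ⊗[k] V} (hx : x ∈ weightSpace k K L V σ s) (hy : y ∈ weightSpace k K L V σ t) :
    LinearMap.BilinForm.baseChange L ψ x y = 0 :=
  baseChange_apply_eq_zero_of_mem_weightSpace σ star ψ hψ
    (fun h => hst ((eq_comp_star_iff σ star ι hσ hι s t).1 h)) hx hy

/-- **Isotropy of a weight space not paired with itself**: if `ι s ≠ s` then `ψ_L` vanishes on
`V_{L,s} × V_{L,s}` (Milne's "`φ|V₁ × V₁ = 0 = φ|V₂ × V₂`" — for a quadratic `k′` with its non-trivial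
involution the two weight spaces are each totally isotropic).
[cite: Milne1999LefschetzClasses, §2 Remark 2.2 (p. 647 L48 – p. 648 L7)] -/
theorem baseChange_apply_eq_zero_of_mem_weightSpace_self
    (hψ : ∀ (a : K) (x y : V), ψ (a • x) y = ψ x (star a • y))
    (hσ : Injective σ) (hι : ∀ s, σ (ι s) = (σ s).comp star) {s : S} (hs : ι s ≠ s)
    {x y : L ⊗[k] V} (hx : x ∈ weightSpace k K L V σ s) (hy : y ∈ weightSpace k K L V σ s) :
    LinearMap.BilinForm.baseChange L ψ x y = 0 :=
  baseChange_apply_eq_zero_of_ne σ star ι ψ hψ hσ hι (Ne.symm hs) hx hy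

variable [Fintype S] [FiniteDimensional k K]
variable (hK : (Algebra.traceForm k K).Nondegenerate)

/-- **`ψ_L(x, y) = ψ_L(x, π_{ιs} y)` for `x ∈ V_{L,s}`**: against a vector of weight `s` only the
`ι s`-component of `y` counts (`y = Σₜ πₜ y` and `V_{L,s} ⊥ V_{L,t}` for `t ≠ ι s`).
[cite: Milne1999LefschetzClasses, §2 Remark 2.2 (p. 647, "there is a nondegenerate Ω-bilinear form φ₁ : V₁ × V₂ → Ω such that φ((x₁,x₂),(y₁,y₂)) = (φ₁(x₁,y₂), −φ₁(x₂,y₁))")] -/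
theorem baseChange_apply_eq_apply_weightProj_of_mem_left
    (hψ : ∀ (a : K) (x y : V), ψ (a • x) y = ψ x (star a • y))
    (hσ : Injective σ) (hcard : Fintype.card S = finrank k K)
    (hι : ∀ s, σ (ι s) = (σ s).comp star) (hstar : ∀ a, star (star a) = a)
    {s : S} {x : L ⊗[k] V} (hx : x ∈ weightSpace k K L V σ s) (y : L ⊗[k] V) :
    LinearMap.BilinForm.baseChange L ψ x y =
      LinearMap.BilinForm.baseChange L ψ x (weightProj k K L V σ hK (Module.finBasis k K) (ι s) y) := by
  conv_lhs => rw [← sum_weightProj_apply k K L V σ hK (Module.finBasis k K) hσ hcard y]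
  rw [map_sum, Finset.sum_eq_single (ι s)]
  · intro t _ hts
    refine baseChange_apply_eq_zero_of_ne σ star ι ψ hψ hσ hι ?_ hx
      (weightProj_apply_mem_weightSpace k K L V σ hK _ t y)
    intro h
    exact hts (by rw [h, ι_ι σ star ι hσ hι hstar])
  · intro h; exact absurd (Finset.mem_univ _) h

/-- **`ψ_L(x, y) = ψ_L(π_{ιt} x, y)` for `y ∈ V_{L,t}`** (the same on the left).
[cite: Milne1999LefschetzClasses, §2 Remark 2.2 (p. 647)] -/
theorem baseChange_apply_eq_apply_weightProj_of_mem_right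
    (hψ : ∀ (a : K) (x y : V), ψ (a • x) y = ψ x (star a • y))
    (hσ : Injective σ) (hcard : Fintype.card S = finrank k K)
    (hι : ∀ s, σ (ι s) = (σ s).comp star)
    {t : S} (x : L ⊗[k] V) {y : L ⊗[k] V} (hy : y ∈ weightSpace k K L V σ t) :
    LinearMap.BilinForm.baseChange L ψ x y =
      LinearMap.BilinForm.baseChange L ψ (weightProj k K L V σ hK (Module.finBasis k K) (ι t) x) y := by
  conv_lhs => rw [← sum_weightProj_apply k K L V σ hK (Module.finBasis k K) hσ hcard x]
  rw [map_sum, LinearMap.sum_apply, Finset.sum_eq_single (ι t)]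
  · intro s _ hst
    exact baseChange_apply_eq_zero_of_ne σ star ι ψ hψ hσ hι hst
      (weightProj_apply_mem_weightSpace k K L V σ hK _ s x) hy
  · intro h; exact absurd (Finset.mem_univ _) h

/-- **Block formula `ψ_L(x, y) = Σₛ ψ_L(πₛ x, π_{ιs} y)`** (Milne's
"`φ((x₁, x₂), (y₁, y₂)) = (φ₁(x₁, y₂), −φ₁(x₂, y₁))`" for any number of weights).
[cite: Milne1999LefschetzClasses, §2 Remark 2.2 (p. 647 L48 – p. 648 L7)] -/
theorem baseChange_apply_eq_sum_weightProj
    (hψ : ∀ (a : K) (x y : V), ψ (a • x) y = ψ x (star a • y))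
    (hσ : Injective σ) (hcard : Fintype.card S = finrank k K)
    (hι : ∀ s, σ (ι s) = (σ s).comp star) (hstar : ∀ a, star (star a) = a) (x y : L ⊗[k] V) :
    LinearMap.BilinForm.baseChange L ψ x y =
      ∑ s, LinearMap.BilinForm.baseChange L ψ (weightProj k K L V σ hK (Module.finBasis k K) s x)
        (weightProj k K L V σ hK (Module.finBasis k K) (ι s) y) := by
  conv_lhs => rw [← sum_weightProj_apply k K L V σ hK (Module.finBasis k K) hσ hcard x]
  rw [map_sum, LinearMap.sum_apply]
  exact Finset.sum_congr rfl fun s _ =>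
    baseChange_apply_eq_apply_weightProj_of_mem_left σ star ι ψ hK hψ hσ hcard hι hstar
      (weightProj_apply_mem_weightSpace k K L V σ hK _ s x) y

end Orthogonality

section Pairing

variable {k : Type uk} [Field k] {K : Type uK} [CommRing K] [Algebra k K]
variable {L : Type uL} [Field L] [Algebra k L]
variable {V : Type uV} [AddCommGroup V] [Module k V] [Module K V] [IsScalarTower k K V]
variable {S : Type uS} (σ : S → (K →ₐ[k] L))
variable (star : K →ₐ[k] K) (ι : S → S)
variable (ψ : LinearMap.BilinForm k V)

/-! ## §2 The pairing `ψ_L : V_{L,s} × V_{L,ιs} → L` is perfect (Milne's "nondegenerate `φ₁ : V₁ × V₂ → Ω`") -/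

/-- **Milne's `φ₁`**: the restriction of `ψ_L` to `V_{L,s} × V_{L,ιs}`.
[cite: Milne1999LefschetzClasses, §2 Remark 2.2 (p. 647 L48 – p. 648 L7, "there is a nondegenerate Ω-bilinear form φ₁ : V₁ × V₂ → Ω")] -/
def weightPairing (s : S) :
    weightSpace k K L V σ s →ₗ[L] weightSpace k K L V σ (ι s) →ₗ[L] L :=
  (LinearMap.BilinForm.baseChange L ψ).compl₁₂ (weightSpace k K L V σ s).subtype
    (weightSpace k K L V σ (ι s)).subtype

/-- `φ₁(x, y) = ψ_L(x, y)`. [cite: Milne1999LefschetzClasses, §2 Remark 2.2 (p. 647)] -/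
@[simp] theorem weightPairing_apply (s : S) (x : weightSpace k K L V σ s) (y : weightSpace k K L V σ (ι s)) :
    weightPairing σ ι ψ s x y = LinearMap.BilinForm.baseChange L ψ (x : L ⊗[k] V) (y : L ⊗[k] V) :=
  rfl

variable [Fintype S] [FiniteDimensional k K] [FiniteDimensional k V]
variable (hK : (Algebra.traceForm k K).Nondegenerate)
include hK

/-- **`φ₁` is non-degenerate on the left**: a vector of `V_{L,s}` orthogonal to `V_{L,ιs}` is orthogonal to
everything (§1), hence zero — `ψ_L` is non-degenerate with `ψ` (Varadarajan / the tree's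
`KillingBaseChange.nondegenerate_baseChange`). [cite: Milne1999LefschetzClasses, §2 Remark 2.2 (p. 647 L48 – p. 648 L7, "nondegenerate Ω-bilinear form φ₁ : V₁ × V₂ → Ω")] -/
theorem weightPairing_injective (hψ : ∀ (a : K) (x y : V), ψ (a • x) y = ψ x (star a • y))
    (hσ : Injective σ) (hcard : Fintype.card S = finrank k K)
    (hι : ∀ s, σ (ι s) = (σ s).comp star) (hstar : ∀ a, star (star a) = a)
    (hnd : ψ.Nondegenerate) (s : S) : Injective (weightPairing σ ι ψ s) := by
  rw [injective_iff_map_eq_zero]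
  intro x hx
  have hsep := (Literature.Algebra.Lie.KillingBaseChange.nondegenerate_baseChange (K := L) hnd).1
  refine Subtype.ext (hsep _ fun y => ?_)
  rw [baseChange_apply_eq_apply_weightProj_of_mem_left σ star ι ψ hK hψ hσ hcard hι hstar x.2 y]
  have h := LinearMap.congr_fun hx ⟨_, weightProj_apply_mem_weightSpace k K L V σ hK (Module.finBasis k K) (ι s) y⟩
  rwa [weightPairing_apply, LinearMap.zero_apply] at h

/-- **`φ₁` is non-degenerate on the right** (the same with `V_{L,ιs}` tested against `V_{L,ι(ιs)} = V_{L,s}`).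
[cite: Milne1999LefschetzClasses, §2 Remark 2.2 (p. 647 L48 – p. 648 L7)] -/
theorem weightPairing_flip_injective (hψ : ∀ (a : K) (x y : V), ψ (a • x) y = ψ x (star a • y))
    (hσ : Injective σ) (hcard : Fintype.card S = finrank k K)
    (hι : ∀ s, σ (ι s) = (σ s).comp star) (hstar : ∀ a, star (star a) = a)
    (hnd : ψ.Nondegenerate) (s : S) : Injective (weightPairing σ ι ψ s).flip := by
  rw [injective_iff_map_eq_zero]
  intro y hy
  have hsep := (Literature.Algebra.Lie.KillingBaseChange.nondegenerate_baseChange (K := L) hnd).2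
  refine Subtype.ext (hsep _ fun x => ?_)
  have h1 := baseChange_apply_eq_apply_weightProj_of_mem_right σ star ι ψ hK hψ hσ hcard hι x y.2
  rw [ι_ι σ star ι hσ hι hstar] at h1
  rw [h1]
  have h := LinearMap.congr_fun hy ⟨_, weightProj_apply_mem_weightSpace k K L V σ hK (Module.finBasis k K) s x⟩
  rwa [LinearMap.flip_apply, weightPairing_apply, LinearMap.zero_apply] at h

/-- **`φ₁ : V_{L,s} × V_{L,ιs} → L` is a perfect pairing** (both partial maps bijective; the spaces are
finite-dimensional over `L`). [cite: Milne1999LefschetzClasses, §2 Remark 2.2 (p. 647 L48 – p. 648 L7, "there is a nondegenerate Ω-bilinear form φ₁ : V₁ × V₂ → Ω")] -/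
theorem isPerfPair_weightPairing (hψ : ∀ (a : K) (x y : V), ψ (a • x) y = ψ x (star a • y))
    (hσ : Injective σ) (hcard : Fintype.card S = finrank k K)
    (hι : ∀ s, σ (ι s) = (σ s).comp star) (hstar : ∀ a, star (star a) = a)
    (hnd : ψ.Nondegenerate) (s : S) :
    LinearMap.IsPerfPair (R := L) (M := weightSpace k K L V σ s) (N := weightSpace k K L V σ (ι s))
      (weightPairing σ ι ψ s) :=
  LinearMap.IsPerfPair.of_injective (weightPairing_injective σ star ι ψ hK hψ hσ hcard hι hstar hnd s)
    (weightPairing_flip_injective σ star ι ψ hK hψ hσ hcard hι hstar hnd s)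

/-- **Paired weight spaces have the same dimension**: `dim_L V_{L,s} = dim_L V_{L,ιs}` (Milne: `V₂ = V₁^∨`;
Deligne: `dim H¹_{B,σ} = dim H¹_{B,σ̄}`). [cite: Milne1999LefschetzClasses, §2 Remark 2.2 (p. 647) and p. 650 L72 ("Let V₂ = V₁^∨")] -/
theorem finrank_weightSpace_eq_finrank_weightSpace_ι
    (hψ : ∀ (a : K) (x y : V), ψ (a • x) y = ψ x (star a • y))
    (hσ : Injective σ) (hcard : Fintype.card S = finrank k K)
    (hι : ∀ s, σ (ι s) = (σ s).comp star) (hstar : ∀ a, star (star a) = a)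
    (hnd : ψ.Nondegenerate) (s : S) :
    finrank L (weightSpace k K L V σ s) = finrank L (weightSpace k K L V σ (ι s)) := by
  haveI := isPerfPair_weightPairing σ star ι ψ hK hψ hσ hcard hι hstar hnd s
  haveI : Module.Free L (weightSpace k K L V σ s) := Module.Free.of_divisionRing L ↥(weightSpace k K L V σ s)
  haveI : Module.Finite L (weightSpace k K L V σ s) := inferInstance
  have h := Module.finrank_of_isPerfPair (R := L) (M := weightSpace k K L V σ s)
    (N := weightSpace k K L V σ (ι s)) (weightPairing σ ι ψ s)
  exact h

end Pairing

section Group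

variable {k : Type uk} [Field k] (K : Type uK) [CommRing K] [Algebra k K]
variable (L : Type uL) [Field L] [Algebra k L]
variable {V : Type uV} [AddCommGroup V] [Module k V] [Module K V] [IsScalarTower k K V]

/-! ## §3 The group `U(φ)(L) = Aut_{k′ ⊗ L}(V ⊗ L, ψ_L)`, its action on the weight spaces, and the contragredient rule -/

/-- **`U(φ)(L)`** — the `L`-points of Milne's unitary group of the (skew-)Hermitian form `φ` (`Tr_{k′/k} ∘ φ = ψ`):
the `L`-linear automorphisms of `L ⊗_k V` commuting with the action of `k′` and preserving `ψ_L` (an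
`L ⊗ k′`-linear automorphism fixes `φ` iff it fixes `Tr ∘ φ = ψ`, Milne p. 646; for an abelian variety with
`E = End⁰(A)` a field this is `S(A)(L) = {γ ∈ C(A) ⊗ L | γ†γ = 1}`, p. 644).
[cite: Milne1999LefschetzClasses, §2 p. 646 L38–L42 ("an L-linear automorphism of V(A) fixes φ if and only if it fixes e_D") and Remark 2.2 p. 647 ("U(φ)_Ω")] -/
def formUnitaryGroup (ψ : LinearMap.BilinForm k V) : Subgroup ((L ⊗[k] V) ≃ₗ[L] (L ⊗[k] V)) where
  carrier := {γ | (∀ (a : K) (x : L ⊗[k] V), γ (actL k K L V a x) = actL k K L V a (γ x)) ∧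
    ∀ x y : L ⊗[k] V, LinearMap.BilinForm.baseChange L ψ (γ x) (γ y) = LinearMap.BilinForm.baseChange L ψ x y}
  one_mem' := ⟨fun _ _ => rfl, fun _ _ => rfl⟩
  mul_mem' := by
    rintro γ δ ⟨hγ₁, hγ₂⟩ ⟨hδ₁, hδ₂⟩
    refine ⟨fun a x => ?_, fun x y => ?_⟩
    · rw [LinearEquiv.mul_apply, LinearEquiv.mul_apply, hδ₁, hγ₁]
    · rw [LinearEquiv.mul_apply, LinearEquiv.mul_apply, hγ₂, hδ₂]
  inv_mem' := by
    rintro γ ⟨hγ₁, hγ₂⟩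
    refine ⟨fun a x => ?_, fun x y => ?_⟩
    · rw [LinearEquiv.coe_inv]
      apply γ.injective
      rw [γ.apply_symm_apply, hγ₁, γ.apply_symm_apply]
    · rw [LinearEquiv.coe_inv, ← hγ₂ (γ.symm x) (γ.symm y), γ.apply_symm_apply, γ.apply_symm_apply]

variable {K L}
variable (ψ : LinearMap.BilinForm k V)

/-- Membership in `U(φ)(L)`: commute with `k′` and preserve `ψ_L`. [cite: Milne1999LefschetzClasses, §1 p. 644 L18 ("S(A)(R) = {γ ∈ C(A) ⊗ R | γ†γ = 1}") and §2 p. 646 L38–L42] -/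
theorem mem_formUnitaryGroup_iff (γ : (L ⊗[k] V) ≃ₗ[L] (L ⊗[k] V)) :
    γ ∈ formUnitaryGroup K L ψ ↔
      (∀ (a : K) (x : L ⊗[k] V), γ (actL k K L V a x) = actL k K L V a (γ x)) ∧
        ∀ x y : L ⊗[k] V, LinearMap.BilinForm.baseChange L ψ (γ x) (γ y) =
          LinearMap.BilinForm.baseChange L ψ x y :=
  Iff.rfl

variable {S : Type uS} (σ : S → (K →ₐ[k] L))

/-- **A map commuting with `k′` preserves every weight space** (Milne: "any `k`-linear map `α : V → V` commuting
with the action of `F` decomposes into `α = α₁ ⊕ ⋯ ⊕ α_t`"). [cite: Milne1999LefschetzClasses, §2 p. 646 L55–L58] -/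
theorem apply_mem_weightSpace_of_comm {f : (L ⊗[k] V) →ₗ[L] (L ⊗[k] V)}
    (hf : ∀ (a : K) (x : L ⊗[k] V), f (actL k K L V a x) = actL k K L V a (f x)) {s : S} {x : L ⊗[k] V}
    (hx : x ∈ weightSpace k K L V σ s) : f x ∈ weightSpace k K L V σ s := by
  rw [mem_weightSpace_iff] at hx ⊢
  intro a
  rw [← hf, hx a, map_smul]

/-- The same for an automorphism `γ`. [cite: Milne1999LefschetzClasses, §2 p. 646 L55–L58] -/
theorem equiv_apply_mem_weightSpace_of_comm {γ : (L ⊗[k] V) ≃ₗ[L] (L ⊗[k] V)}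
    (hγ : ∀ (a : K) (x : L ⊗[k] V), γ (actL k K L V a x) = actL k K L V a (γ x)) {s : S} {x : L ⊗[k] V}
    (hx : x ∈ weightSpace k K L V σ s) : γ x ∈ weightSpace k K L V σ s :=
  apply_mem_weightSpace_of_comm σ (f := (γ : (L ⊗[k] V) →ₗ[L] (L ⊗[k] V))) (fun a x => hγ a x) hx

/-- The inverse of an automorphism commuting with `k′` commutes with `k′`. [folklore] -/
private theorem symm_comm {γ : (L ⊗[k] V) ≃ₗ[L] (L ⊗[k] V)}
    (hγ : ∀ (a : K) (x : L ⊗[k] V), γ (actL k K L V a x) = actL k K L V a (γ x)) (a : K) (x : L ⊗[k] V) :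
    γ.symm (actL k K L V a x) = actL k K L V a (γ.symm x) := by
  apply γ.injective
  rw [γ.apply_symm_apply, hγ, γ.apply_symm_apply]

/-- An automorphism commuting with `k′` maps each weight space ONTO itself. [cite: Milne1999LefschetzClasses, §2 p. 646 L55–L58 ("αᵢ : Vᵢ → Vᵢ")] -/
theorem map_weightSpace_eq_of_comm {γ : (L ⊗[k] V) ≃ₗ[L] (L ⊗[k] V)}
    (hγ : ∀ (a : K) (x : L ⊗[k] V), γ (actL k K L V a x) = actL k K L V a (γ x)) (s : S) :
    (weightSpace k K L V σ s).map (γ : (L ⊗[k] V) →ₗ[L] (L ⊗[k] V)) = weightSpace k K L V σ s := by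
  refine le_antisymm ?_ fun x hx => ?_
  · rintro _ ⟨x, hx, rfl⟩
    exact equiv_apply_mem_weightSpace_of_comm σ hγ hx
  · exact ⟨γ.symm x, equiv_apply_mem_weightSpace_of_comm σ (symm_comm hγ) hx, γ.apply_symm_apply x⟩

/-- **`γ|V_{L,s}`** — the block of an automorphism commuting with `k′` on the weight space `V_{L,s}`, as an
automorphism of `V_{L,s}` (Milne's `αᵢ`, resp. `α|V₁`). [cite: Milne1999LefschetzClasses, §2 p. 646 L55–L58 and Remark 2.2 p. 647 ("α ↦ α|V₁")] -/
def restrictWeightSpace (γ : (L ⊗[k] V) ≃ₗ[L] (L ⊗[k] V))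
    (hγ : ∀ (a : K) (x : L ⊗[k] V), γ (actL k K L V a x) = actL k K L V a (γ x)) (s : S) :
    weightSpace k K L V σ s ≃ₗ[L] weightSpace k K L V σ s :=
  LinearEquiv.ofSubmodules γ _ _ (map_weightSpace_eq_of_comm σ hγ s)

/-- `γ|V_{L,s}` is `γ` on `V_{L,s}`. [cite: Milne1999LefschetzClasses, §2 Remark 2.2 (p. 647, "α ↦ α|V₁")] -/
@[simp] theorem coe_restrictWeightSpace_apply (γ : (L ⊗[k] V) ≃ₗ[L] (L ⊗[k] V))
    (hγ : ∀ (a : K) (x : L ⊗[k] V), γ (actL k K L V a x) = actL k K L V a (γ x)) (s : S)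
    (x : weightSpace k K L V σ s) :
    (restrictWeightSpace σ γ hγ s x : L ⊗[k] V) = γ x :=
  LinearEquiv.ofSubmodules_apply γ _ x

/-- **`α ↦ α|V_{L,s} : U(φ)(L) → GL(V_{L,s})`** as a group homomorphism.
[cite: Milne1999LefschetzClasses, §2 Remark 2.2 (p. 647 L69 – p. 648 L5, "the map α ↦ α|V₁ : U(φ)_Ω → GL(V₁)")] -/
def restrictHom (s : S) :
    formUnitaryGroup K L ψ →* (weightSpace k K L V σ s ≃ₗ[L] weightSpace k K L V σ s) where
  toFun γ := restrictWeightSpace σ (γ : (L ⊗[k] V) ≃ₗ[L] (L ⊗[k] V)) γ.2.1 s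
  map_one' := by
    refine LinearEquiv.ext fun x => Subtype.ext ?_
    rw [coe_restrictWeightSpace_apply]
    rfl
  map_mul' γ δ := by
    refine LinearEquiv.ext fun x => Subtype.ext ?_
    rw [coe_restrictWeightSpace_apply, LinearEquiv.mul_apply, coe_restrictWeightSpace_apply,
      coe_restrictWeightSpace_apply]
    rfl

/-- `(restrictHom s γ) x = γ x`. [cite: Milne1999LefschetzClasses, §2 Remark 2.2 (p. 647, "α ↦ α|V₁")] -/
@[simp] theorem coe_restrictHom_apply (s : S) (γ : formUnitaryGroup K L ψ) (x : weightSpace k K L V σ s) :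
    (restrictHom ψ σ s γ x : L ⊗[k] V) = (γ : (L ⊗[k] V) ≃ₗ[L] (L ⊗[k] V)) x :=
  coe_restrictWeightSpace_apply σ (γ : (L ⊗[k] V) ≃ₗ[L] (L ⊗[k] V)) γ.2.1 s x

variable (ι : S → S)

/-- **The contragredient rule** — "the representation of `U(φ)` on `V₂` is the contragredient of [that] on `V₁`":
for `γ ∈ U(φ)(L)`, `φ₁(γ|V_{L,s} x, γ|V_{L,ιs} y) = φ₁(x, y)`.
[cite: Milne1999LefschetzClasses, §2 Remark 2.2 (p. 647 L69 – p. 648 L7, "the representation of U(φ)_Ω on V ⊗_k Ω becomes the direct sum of the representation of GL(V₁) on V₁ (standard representation) and the representation of GL(V₁) on V₂ (contragredient of the standard representation)")] -/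
theorem weightPairing_restrictHom_restrictHom (s : S) (γ : formUnitaryGroup K L ψ)
    (x : weightSpace k K L V σ s) (y : weightSpace k K L V σ (ι s)) :
    weightPairing σ ι ψ s (restrictHom ψ σ s γ x) (restrictHom ψ σ (ι s) γ y) = weightPairing σ ι ψ s x y := by
  rw [weightPairing_apply, weightPairing_apply, coe_restrictHom_apply, coe_restrictHom_apply]
  exact γ.2.2 _ _

variable (star : K →ₐ[k] K)
variable [Fintype S] [FiniteDimensional k K] [FiniteDimensional k V]
variable (hK : (Algebra.traceForm k K).Nondegenerate)
include hK

/-- **`γ|V_{L,s}` determines `γ|V_{L,ιs}`**: two elements of `U(φ)(L)` that agree on `V_{L,s}` agree on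
`V_{L,ιs}` (test `ψ_L(γx′, γy − δy)` against `x′ ∈ γ(V_{L,s}) = V_{L,s}` and use the non-degeneracy of `φ₁`).
[cite: Milne1999LefschetzClasses, §2 Remark 2.2 (p. 647 L69 – p. 648 L5, "α ↦ α|V₁ : U(φ)_Ω → GL(V₁) is an isomorphism" — injectivity)] -/
theorem eqOn_weightSpace_ι_of_eqOn (hψ : ∀ (a : K) (x y : V), ψ (a • x) y = ψ x (star a • y))
    (hσ : Injective σ) (hcard : Fintype.card S = finrank k K)
    (hι : ∀ s, σ (ι s) = (σ s).comp star) (hstar : ∀ a, star (star a) = a)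
    (hnd : ψ.Nondegenerate) {s : S} {γ δ : (L ⊗[k] V) ≃ₗ[L] (L ⊗[k] V)}
    (hγ : γ ∈ formUnitaryGroup K L ψ) (hδ : δ ∈ formUnitaryGroup K L ψ)
    (h : ∀ x ∈ weightSpace k K L V σ s, γ x = δ x) :
    ∀ y ∈ weightSpace k K L V σ (ι s), γ y = δ y := by
  intro y hy
  have hγy := equiv_apply_mem_weightSpace_of_comm σ hγ.1 hy
  have hδy := equiv_apply_mem_weightSpace_of_comm σ hδ.1 hy
  suffices heq : (⟨γ y, hγy⟩ : weightSpace k K L V σ (ι s)) = ⟨δ y, hδy⟩ from congrArg Subtype.val heq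
  apply weightPairing_flip_injective σ star ι ψ hK hψ hσ hcard hι hstar hnd s
  refine LinearMap.ext fun x => ?_
  rw [LinearMap.flip_apply, LinearMap.flip_apply, weightPairing_apply, weightPairing_apply]
  have hx' : γ.symm x ∈ weightSpace k K L V σ s := equiv_apply_mem_weightSpace_of_comm σ (symm_comm hγ.1) x.2
  calc LinearMap.BilinForm.baseChange L ψ (x : L ⊗[k] V) (γ y)
      = LinearMap.BilinForm.baseChange L ψ (γ (γ.symm x)) (γ y) := by rw [γ.apply_symm_apply]
    _ = LinearMap.BilinForm.baseChange L ψ (γ.symm x) y := hγ.2 _ _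
    _ = LinearMap.BilinForm.baseChange L ψ (δ (γ.symm x)) (δ y) := (hδ.2 _ _).symm
    _ = LinearMap.BilinForm.baseChange L ψ (x : L ⊗[k] V) (δ y) := by rw [← h _ hx', γ.apply_symm_apply]

/-- **Injectivity of `α ↦ (α|V_{L,s})_{s ∈ Φ}`** for a set `Φ` of weights meeting every pair `{s, ιs}`:
an element of `U(φ)(L)` is determined by its blocks on the `V_{L,s}`, `s ∈ Φ` (Milne: `Φ = {σ₁}`).
[cite: Milne1999LefschetzClasses, §2 Remark 2.2 (p. 647 L69 – p. 648 L5, "α ↦ α|V₁ : U(φ)_Ω → GL(V₁) is an isomorphism")] -/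
theorem eq_of_eqOn_weightSpace (hψ : ∀ (a : K) (x y : V), ψ (a • x) y = ψ x (star a • y))
    (hσ : Injective σ) (hcard : Fintype.card S = finrank k K)
    (hι : ∀ s, σ (ι s) = (σ s).comp star) (hstar : ∀ a, star (star a) = a)
    (hnd : ψ.Nondegenerate) (Φ : Finset S) (hΦ : ∀ s, s ∈ Φ ∨ ι s ∈ Φ)
    {γ δ : (L ⊗[k] V) ≃ₗ[L] (L ⊗[k] V)} (hγ : γ ∈ formUnitaryGroup K L ψ) (hδ : δ ∈ formUnitaryGroup K L ψ)
    (h : ∀ s ∈ Φ, ∀ x ∈ weightSpace k K L V σ s, γ x = δ x) : γ = δ := by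
  have hall : ∀ s, ∀ x ∈ weightSpace k K L V σ s, γ x = δ x := by
    intro s
    rcases hΦ s with hs | hs
    · exact h s hs
    · have h2 := eqOn_weightSpace_ι_of_eqOn ψ σ ι star hK hψ hσ hcard hι hstar hnd hγ hδ (h (ι s) hs)
      rwa [ι_ι σ star ι hσ hι hstar] at h2
  refine LinearEquiv.ext fun w => ?_
  rw [← sum_weightProj_apply k K L V σ hK (Module.finBasis k K) hσ hcard w, map_sum, map_sum]
  exact Finset.sum_congr rfl fun s _ =>
    hall s _ (weightProj_apply_mem_weightSpace k K L V σ hK (Module.finBasis k K) s w)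

/-- The same injectivity, phrased with `restrictHom`. [cite: Milne1999LefschetzClasses, §2 Remark 2.2 (p. 647 L69 – p. 648 L5)] -/
theorem restrictHom_injective_of_cover (hψ : ∀ (a : K) (x y : V), ψ (a • x) y = ψ x (star a • y))
    (hσ : Injective σ) (hcard : Fintype.card S = finrank k K)
    (hι : ∀ s, σ (ι s) = (σ s).comp star) (hstar : ∀ a, star (star a) = a)
    (hnd : ψ.Nondegenerate) (Φ : Finset S) (hΦ : ∀ s, s ∈ Φ ∨ ι s ∈ Φ)
    {γ δ : formUnitaryGroup K L ψ} (h : ∀ s ∈ Φ, restrictHom ψ σ s γ = restrictHom ψ σ s δ) : γ = δ := by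
  refine Subtype.ext (eq_of_eqOn_weightSpace ψ σ ι star hK hψ hσ hcard hι hstar hnd Φ hΦ γ.2 δ.2 ?_)
  intro s hs x hx
  have h1 := congrArg (fun e => ((e ⟨x, hx⟩ : weightSpace k K L V σ s) : L ⊗[k] V)) (h s hs)
  simpa only [coe_restrictHom_apply] using h1

end Group

section Extension

variable {k : Type uk} [Field k] {K : Type uK} [CommRing K] [Algebra k K]
variable {L : Type uL} [Field L] [Algebra k L]
variable {V : Type uV} [AddCommGroup V] [Module k V] [Module K V] [IsScalarTower k K V]
variable {S : Type uS} (σ : S → (K →ₐ[k] L)) (star : K →ₐ[k] K) (ι : S → S)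
variable (ψ : LinearMap.BilinForm k V)
variable [Fintype S] [FiniteDimensional k K] [FiniteDimensional k V]

/-! ## §4 The contragredient `g ↦ ᵗg⁻¹` on `V_{L,ιs}` and the extension of a family of blocks to an element of `U(φ)(L)` -/

/-- **`V_{L,ιs} ≅ V_{L,s}^∨` by `y ↦ φ₁(·, y)`** (Milne's "`V₂ = V₁^∨`"), from the perfect pairing `φ₁`.
[cite: Milne1999LefschetzClasses, §2 Remark 2.2 (p. 647) and p. 650 L72 ("Let V₂ = V₁^∨")] -/
def weightDuality (hK : (Algebra.traceForm k K).Nondegenerate)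
    (hψ : ∀ (a : K) (x y : V), ψ (a • x) y = ψ x (star a • y))
    (hσ : Injective σ) (hcard : Fintype.card S = finrank k K)
    (hι : ∀ s, σ (ι s) = (σ s).comp star) (hstar : ∀ a, star (star a) = a)
    (hnd : ψ.Nondegenerate) (s : S) :
    weightSpace k K L V σ (ι s) ≃ₗ[L] Module.Dual L (weightSpace k K L V σ s) :=
  haveI := isPerfPair_weightPairing σ star ι ψ hK hψ hσ hcard hι hstar hnd s
  LinearMap.toPerfPair (R := L) (M := weightSpace k K L V σ (ι s)) (N := weightSpace k K L V σ s)
    (weightPairing σ ι ψ s).flip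

/-- `weightDuality y x = ψ_L(x, y)`. [cite: Milne1999LefschetzClasses, §2 Remark 2.2 (p. 647)] -/
@[simp] theorem weightDuality_apply (hK : (Algebra.traceForm k K).Nondegenerate)
    (hψ : ∀ (a : K) (x y : V), ψ (a • x) y = ψ x (star a • y))
    (hσ : Injective σ) (hcard : Fintype.card S = finrank k K)
    (hι : ∀ s, σ (ι s) = (σ s).comp star) (hstar : ∀ a, star (star a) = a)
    (hnd : ψ.Nondegenerate) (s : S) (y : weightSpace k K L V σ (ι s)) (x : weightSpace k K L V σ s) :
    weightDuality σ star ι ψ hK hψ hσ hcard hι hstar hnd s y x =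
      LinearMap.BilinForm.baseChange L ψ (x : L ⊗[k] V) (y : L ⊗[k] V) :=
  rfl

/-- **The contragredient `g ↦ ᵗg⁻¹`**: the automorphism of `V_{L,ιs} ≅ V_{L,s}^∨` dual-inverse to an automorphism
`g` of `V_{L,s}` — the unique `g′` with `φ₁(g x, g′ y) = φ₁(x, y)` ("the representation of `GL(V₁)` on `V₂`
(contragredient of the standard representation)"). [cite: Milne1999LefschetzClasses, §2 Remark 2.2 (p. 647 L69 – p. 648 L7)] -/
def contragredient (hK : (Algebra.traceForm k K).Nondegenerate)
    (hψ : ∀ (a : K) (x y : V), ψ (a • x) y = ψ x (star a • y))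
    (hσ : Injective σ) (hcard : Fintype.card S = finrank k K)
    (hι : ∀ s, σ (ι s) = (σ s).comp star) (hstar : ∀ a, star (star a) = a)
    (hnd : ψ.Nondegenerate) (s : S)
    (g : weightSpace k K L V σ s ≃ₗ[L] weightSpace k K L V σ s) :
    weightSpace k K L V σ (ι s) ≃ₗ[L] weightSpace k K L V σ (ι s) :=
  (weightDuality σ star ι ψ hK hψ hσ hcard hι hstar hnd s).trans
    (g.symm.dualMap.trans (weightDuality σ star ι ψ hK hψ hσ hcard hι hstar hnd s).symm)

/-- **`φ₁(g x, ᵗg⁻¹ y) = φ₁(x, y)`** — the standard ⊕ contragredient pair preserves `φ₁`.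
[cite: Milne1999LefschetzClasses, §2 Remark 2.2 (p. 647 L69 – p. 648 L7, "standard representation … contragredient of the standard representation")] -/
theorem weightPairing_apply_contragredient (hK : (Algebra.traceForm k K).Nondegenerate)
    (hψ : ∀ (a : K) (x y : V), ψ (a • x) y = ψ x (star a • y))
    (hσ : Injective σ) (hcard : Fintype.card S = finrank k K)
    (hι : ∀ s, σ (ι s) = (σ s).comp star) (hstar : ∀ a, star (star a) = a)
    (hnd : ψ.Nondegenerate) (s : S)
    (g : weightSpace k K L V σ s ≃ₗ[L] weightSpace k K L V σ s)
    (x : weightSpace k K L V σ s) (y : weightSpace k K L V σ (ι s)) :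
    weightPairing σ ι ψ s (g x) (contragredient σ star ι ψ hK hψ hσ hcard hι hstar hnd s g y) =
      weightPairing σ ι ψ s x y := by
  rw [weightPairing_apply, weightPairing_apply,
    ← weightDuality_apply σ star ι ψ hK hψ hσ hcard hι hstar hnd s _ (g x), contragredient,
    LinearEquiv.trans_apply, LinearEquiv.trans_apply, LinearEquiv.apply_symm_apply, LinearEquiv.dualMap_apply,
    LinearEquiv.symm_apply_apply, weightDuality_apply]

/-- **Uniqueness of the contragredient**: an automorphism `g′` of `V_{L,ιs}` with `φ₁(g x, g′ y) = φ₁(x, y)` for all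
`x, y` IS `ᵗg⁻¹` (non-degeneracy of `φ₁`). [cite: Milne1999LefschetzClasses, §2 Remark 2.2 (p. 647 L69 – p. 648 L5)] -/
theorem eq_contragredient_of_forall (hK : (Algebra.traceForm k K).Nondegenerate)
    (hψ : ∀ (a : K) (x y : V), ψ (a • x) y = ψ x (star a • y))
    (hσ : Injective σ) (hcard : Fintype.card S = finrank k K)
    (hι : ∀ s, σ (ι s) = (σ s).comp star) (hstar : ∀ a, star (star a) = a)
    (hnd : ψ.Nondegenerate) (s : S)
    (g : weightSpace k K L V σ s ≃ₗ[L] weightSpace k K L V σ s)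
    (g' : weightSpace k K L V σ (ι s) ≃ₗ[L] weightSpace k K L V σ (ι s))
    (h : ∀ x y, weightPairing σ ι ψ s (g x) (g' y) = weightPairing σ ι ψ s x y) :
    g' = contragredient σ star ι ψ hK hψ hσ hcard hι hstar hnd s g := by
  refine LinearEquiv.ext fun y => ?_
  apply weightPairing_flip_injective σ star ι ψ hK hψ hσ hcard hι hstar hnd s
  refine LinearMap.ext fun x => ?_
  rw [LinearMap.flip_apply, LinearMap.flip_apply]
  conv_lhs => rw [← g.apply_symm_apply x, h]
  conv_rhs => rw [← g.apply_symm_apply x,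
    weightPairing_apply_contragredient σ star ι ψ hK hψ hσ hcard hι hstar hnd s g]

/-- **"The representation on `V₂` is the contragredient of the standard representation"**: for `γ ∈ U(φ)(L)`,
`γ|V_{L,ιs} = ᵗ(γ|V_{L,s})⁻¹`. [cite: Milne1999LefschetzClasses, §2 Remark 2.2 (p. 647 L69 – p. 648 L7) and p. 650 L33–L36 (types II/III: "γ ↦ γ|V_{σ₁} identifies U(φ_{1,σ}) ∩ Sp(φ_{2,σ}) with Sp(φ_{2,σ₁}) … its representation on V_{σ₂} is the contragredient of the standard representation")] -/
theorem restrictHom_ι_eq_contragredient (hK : (Algebra.traceForm k K).Nondegenerate)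
    (hψ : ∀ (a : K) (x y : V), ψ (a • x) y = ψ x (star a • y))
    (hσ : Injective σ) (hcard : Fintype.card S = finrank k K)
    (hι : ∀ s, σ (ι s) = (σ s).comp star) (hstar : ∀ a, star (star a) = a)
    (hnd : ψ.Nondegenerate) (s : S) (γ : formUnitaryGroup K L ψ) :
    restrictHom ψ σ (ι s) γ =
      contragredient σ star ι ψ hK hψ hσ hcard hι hstar hnd s (restrictHom ψ σ s γ) :=
  eq_contragredient_of_forall σ star ι ψ hK hψ hσ hcard hι hstar hnd s _ _
    (weightPairing_restrictHom_restrictHom ψ σ ι s γ)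

/-- The projector `π_t` with values in `V_{L,t}`. [cite: Deligne1982HodgeCycles, §4 proof of Prop. 4.4 (re-ed. p. 30, "H¹_B(A) ⊗ ℂ ⥲ ⊕_σ H¹_{B,σ}")] -/
def weightProjCod (hK : (Algebra.traceForm k K).Nondegenerate) (t : S) :
    (L ⊗[k] V) →ₗ[L] weightSpace k K L V σ t :=
  LinearMap.codRestrict _ (weightProj k K L V σ hK (Module.finBasis k K) t)
    (weightProj_apply_mem_weightSpace k K L V σ hK (Module.finBasis k K) t)

omit [Fintype S] [FiniteDimensional k V] in
/-- `weightProjCod t x = π_t x`. [cite: Deligne1982HodgeCycles, §4 proof of Prop. 4.4 (re-ed. p. 30)] -/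
@[simp] theorem coe_weightProjCod_apply (hK : (Algebra.traceForm k K).Nondegenerate) (t : S) (x : L ⊗[k] V) :
    (weightProjCod σ hK t x : L ⊗[k] V) = weightProj k K L V σ hK (Module.finBasis k K) t x :=
  rfl

omit [Fintype S] [FiniteDimensional k V] in
/-- A map commuting with `k′` commutes with the projectors `π_t` (which are `L`-combinations of the action).
[cite: Deligne1982HodgeCycles, §4 proof of Prop. 4.4 (re-ed. p. 30, "(E-linear isomorphism)")] -/
theorem weightProj_apply_comm_of_comm (hK : (Algebra.traceForm k K).Nondegenerate)
    {f : (L ⊗[k] V) →ₗ[L] (L ⊗[k] V)}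
    (hf : ∀ (a : K) (x : L ⊗[k] V), f (actL k K L V a x) = actL k K L V a (f x)) (t : S) (x : L ⊗[k] V) :
    weightProj k K L V σ hK (Module.finBasis k K) t (f x) = f (weightProj k K L V σ hK (Module.finBasis k K) t x) := by
  simp only [weightProj, LinearMap.sum_apply, LinearMap.smul_apply, map_sum, map_smul, hf]

variable (Φ : Finset S)

/-- **The extension `⊕_{s ∈ Φ} (g_s ⊕ ᵗg_s⁻¹)`** of a family of automorphisms `g_s ∈ GL(V_{L,s})`, `s ∈ Φ`, by
their contragredients on the partners `V_{L,ιs}` — the inverse of `α ↦ (α|V_{L,s})_{s ∈ Φ}` (Milne: of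
`α ↦ α|V₁`), as an endomorphism of `L ⊗_k V`. [cite: Milne1999LefschetzClasses, §2 Remark 2.2 (p. 647 L69 – p. 648 L7)] -/
def extend (hK : (Algebra.traceForm k K).Nondegenerate)
    (hψ : ∀ (a : K) (x y : V), ψ (a • x) y = ψ x (star a • y))
    (hσ : Injective σ) (hcard : Fintype.card S = finrank k K)
    (hι : ∀ s, σ (ι s) = (σ s).comp star) (hstar : ∀ a, star (star a) = a)
    (hnd : ψ.Nondegenerate)
    (g : ∀ s : Φ, weightSpace k K L V σ s ≃ₗ[L] weightSpace k K L V σ s) :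
    (L ⊗[k] V) →ₗ[L] (L ⊗[k] V) :=
  ∑ s : Φ, ((weightSpace k K L V σ (s : S)).subtype ∘ₗ (g s : weightSpace k K L V σ s →ₗ[L] weightSpace k K L V σ s) ∘ₗ
      weightProjCod σ hK (s : S) +
    (weightSpace k K L V σ (ι s)).subtype ∘ₗ
      (contragredient σ star ι ψ hK hψ hσ hcard hι hstar hnd s (g s) :
        weightSpace k K L V σ (ι s) →ₗ[L] weightSpace k K L V σ (ι s)) ∘ₗ weightProjCod σ hK (ι s))

/-- **On `V_{L,s}`, `s ∈ Φ`, the extension is `g_s`** (for `Φ` disjoint from `ιΦ`).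
[cite: Milne1999LefschetzClasses, §2 Remark 2.2 (p. 647 L69 – p. 648 L5)] -/
theorem extend_apply_of_mem (hK : (Algebra.traceForm k K).Nondegenerate)
    (hψ : ∀ (a : K) (x y : V), ψ (a • x) y = ψ x (star a • y))
    (hσ : Injective σ) (hcard : Fintype.card S = finrank k K)
    (hι : ∀ s, σ (ι s) = (σ s).comp star) (hstar : ∀ a, star (star a) = a)
    (hnd : ψ.Nondegenerate) (hΦ : ∀ s ∈ Φ, ι s ∉ Φ)
    (g : ∀ s : Φ, weightSpace k K L V σ s ≃ₗ[L] weightSpace k K L V σ s)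
    {s₀ : S} (hs₀ : s₀ ∈ Φ) {x : L ⊗[k] V} (hx : x ∈ weightSpace k K L V σ s₀) :
    extend σ star ι ψ Φ hK hψ hσ hcard hι hstar hnd g x = g ⟨s₀, hs₀⟩ ⟨x, hx⟩ := by
  classical
  rw [extend, LinearMap.sum_apply, Finset.sum_eq_single ⟨s₀, hs₀⟩]
  · have hne : ι s₀ ≠ s₀ := fun h => hΦ s₀ hs₀ (by rw [h]; exact hs₀)
    have hπ1 : weightProjCod σ hK s₀ x = ⟨x, hx⟩ :=
      Subtype.ext (weightProj_apply_eq_self_of_mem k K L V σ hK _ hσ hcard hx)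
    have hπ2 : weightProjCod σ hK (ι s₀) x = 0 :=
      Subtype.ext (weightProj_apply_eq_zero_of_mem k K L V σ hK _ hσ hcard hne hx)
    simp only [LinearMap.add_apply, LinearMap.comp_apply, hπ1, hπ2, map_zero, add_zero, Submodule.subtype_apply,
      LinearEquiv.coe_coe]
  · intro s _ hs
    have h1 : (s : S) ≠ s₀ := fun h => hs (Subtype.ext h)
    have h2 : ι (s : S) ≠ s₀ := fun h => hΦ s s.2 (by rw [h]; exact hs₀)
    have hπ1 : weightProjCod σ hK (s : S) x = 0 :=
      Subtype.ext (weightProj_apply_eq_zero_of_mem k K L V σ hK _ hσ hcard h1 hx)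
    have hπ2 : weightProjCod σ hK (ι s) x = 0 :=
      Subtype.ext (weightProj_apply_eq_zero_of_mem k K L V σ hK _ hσ hcard h2 hx)
    simp only [LinearMap.add_apply, LinearMap.comp_apply, hπ1, hπ2, map_zero, add_zero]
  · intro h; exact absurd (Finset.mem_univ _) h

/-- **On `V_{L,ιs}`, `s ∈ Φ`, the extension is `ᵗg_s⁻¹`**. [cite: Milne1999LefschetzClasses, §2 Remark 2.2 (p. 647 L69 – p. 648 L7)] -/
theorem extend_apply_of_mem_ι (hK : (Algebra.traceForm k K).Nondegenerate)
    (hψ : ∀ (a : K) (x y : V), ψ (a • x) y = ψ x (star a • y))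
    (hσ : Injective σ) (hcard : Fintype.card S = finrank k K)
    (hι : ∀ s, σ (ι s) = (σ s).comp star) (hstar : ∀ a, star (star a) = a)
    (hnd : ψ.Nondegenerate) (hΦ : ∀ s ∈ Φ, ι s ∉ Φ)
    (g : ∀ s : Φ, weightSpace k K L V σ s ≃ₗ[L] weightSpace k K L V σ s)
    {s₀ : S} (hs₀ : s₀ ∈ Φ) {y : L ⊗[k] V} (hy : y ∈ weightSpace k K L V σ (ι s₀)) :
    extend σ star ι ψ Φ hK hψ hσ hcard hι hstar hnd g y =
      contragredient σ star ι ψ hK hψ hσ hcard hι hstar hnd s₀ (g ⟨s₀, hs₀⟩) ⟨y, hy⟩ := by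
  classical
  rw [extend, LinearMap.sum_apply, Finset.sum_eq_single ⟨s₀, hs₀⟩]
  · have hne : s₀ ≠ ι s₀ := fun h => hΦ s₀ hs₀ (by rw [← h]; exact hs₀)
    have hπ1 : weightProjCod σ hK s₀ y = 0 :=
      Subtype.ext (weightProj_apply_eq_zero_of_mem k K L V σ hK _ hσ hcard hne hy)
    have hπ2 : weightProjCod σ hK (ι s₀) y = ⟨y, hy⟩ :=
      Subtype.ext (weightProj_apply_eq_self_of_mem k K L V σ hK _ hσ hcard hy)
    simp only [LinearMap.add_apply, LinearMap.comp_apply, hπ1, hπ2, map_zero, zero_add, Submodule.subtype_apply,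
      LinearEquiv.coe_coe]
  · intro s _ hs
    have h0 : (s : S) ≠ s₀ := fun h => hs (Subtype.ext h)
    have h1 : (s : S) ≠ ι s₀ := fun h => hΦ s₀ hs₀ (by rw [← h]; exact s.2)
    have h2 : ι (s : S) ≠ ι s₀ := fun h => h0 (by
      have h' := congrArg ι h
      rwa [ι_ι σ star ι hσ hι hstar, ι_ι σ star ι hσ hι hstar] at h')
    have hπ1 : weightProjCod σ hK (s : S) y = 0 :=
      Subtype.ext (weightProj_apply_eq_zero_of_mem k K L V σ hK _ hσ hcard h1 hy)
    have hπ2 : weightProjCod σ hK (ι s) y = 0 :=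
      Subtype.ext (weightProj_apply_eq_zero_of_mem k K L V σ hK _ hσ hcard h2 hy)
    simp only [LinearMap.add_apply, LinearMap.comp_apply, hπ1, hπ2, map_zero, add_zero]
  · intro h; exact absurd (Finset.mem_univ _) h

/-- The extension preserves every weight space (for `Φ` a set of representatives of the pairs `{s, ιs}`).
[cite: Milne1999LefschetzClasses, §2 Remark 2.2 (p. 647 L69 – p. 648 L5)] -/
theorem extend_apply_mem (hK : (Algebra.traceForm k K).Nondegenerate)
    (hψ : ∀ (a : K) (x y : V), ψ (a • x) y = ψ x (star a • y))
    (hσ : Injective σ) (hcard : Fintype.card S = finrank k K)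
    (hι : ∀ s, σ (ι s) = (σ s).comp star) (hstar : ∀ a, star (star a) = a)
    (hnd : ψ.Nondegenerate) (hΦ₁ : ∀ s, s ∈ Φ ∨ ι s ∈ Φ) (hΦ₂ : ∀ s ∈ Φ, ι s ∉ Φ)
    (g : ∀ s : Φ, weightSpace k K L V σ s ≃ₗ[L] weightSpace k K L V σ s)
    {t : S} {x : L ⊗[k] V} (hx : x ∈ weightSpace k K L V σ t) :
    extend σ star ι ψ Φ hK hψ hσ hcard hι hstar hnd g x ∈ weightSpace k K L V σ t := by
  rcases hΦ₁ t with ht | ht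
  · rw [extend_apply_of_mem σ star ι ψ Φ hK hψ hσ hcard hι hstar hnd hΦ₂ g ht hx]
    exact (g ⟨t, ht⟩ ⟨x, hx⟩).2
  · have hx' : x ∈ weightSpace k K L V σ (ι (ι t)) := by rw [ι_ι σ star ι hσ hι hstar]; exact hx
    rw [extend_apply_of_mem_ι σ star ι ψ Φ hK hψ hσ hcard hι hstar hnd hΦ₂ g ht hx']
    have e : weightSpace k K L V σ t = weightSpace k K L V σ (ι (ι t)) := by rw [ι_ι σ star ι hσ hι hstar]
    rw [e]
    exact (contragredient σ star ι ψ hK hψ hσ hcard hι hstar hnd (ι t) (g ⟨ι t, ht⟩) ⟨x, hx'⟩).2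

/-- **The extension commutes with `k′`** (it preserves the weight spaces, on which `k′` acts by scalars).
[cite: Milne1999LefschetzClasses, §2 Remark 2.2 (p. 647 L69 – p. 648 L5)] -/
theorem extend_comm (hK : (Algebra.traceForm k K).Nondegenerate)
    (hψ : ∀ (a : K) (x y : V), ψ (a • x) y = ψ x (star a • y))
    (hσ : Injective σ) (hcard : Fintype.card S = finrank k K)
    (hι : ∀ s, σ (ι s) = (σ s).comp star) (hstar : ∀ a, star (star a) = a)
    (hnd : ψ.Nondegenerate) (hΦ₁ : ∀ s, s ∈ Φ ∨ ι s ∈ Φ) (hΦ₂ : ∀ s ∈ Φ, ι s ∉ Φ)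
    (g : ∀ s : Φ, weightSpace k K L V σ s ≃ₗ[L] weightSpace k K L V σ s) (a : K) (x : L ⊗[k] V) :
    extend σ star ι ψ Φ hK hψ hσ hcard hι hstar hnd g (actL k K L V a x) =
      actL k K L V a (extend σ star ι ψ Φ hK hψ hσ hcard hι hstar hnd g x) := by
  rw [← sum_weightProj_apply k K L V σ hK (Module.finBasis k K) hσ hcard x, map_sum, map_sum, map_sum, map_sum]
  refine Finset.sum_congr rfl fun t _ => ?_
  have hxt := weightProj_apply_mem_weightSpace k K L V σ hK (Module.finBasis k K) t x
  have hEt := extend_apply_mem σ star ι ψ Φ hK hψ hσ hcard hι hstar hnd hΦ₁ hΦ₂ g hxt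
  rw [mem_weightSpace_iff] at hxt hEt
  rw [hxt a, map_smul, hEt a]

omit [Fintype S] [FiniteDimensional k K] [FiniteDimensional k V] in
/-- `ψ_L(y, x) = ε ψ_L(x, y)` if `ψ(y, x) = ε ψ(x, y)` (base change of `ε`-symmetry). [folklore] -/
private theorem baseChange_swap_eq_smul {ε : k} (hε : ∀ x y : V, ψ y x = ε * ψ x y) (x y : L ⊗[k] V) :
    LinearMap.BilinForm.baseChange L ψ y x = algebraMap k L ε * LinearMap.BilinForm.baseChange L ψ x y := by
  induction x using TensorProduct.induction_on generalizing y with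
  | zero => simp
  | add x₁ x₂ h₁ h₂ => simp only [map_add, LinearMap.add_apply, h₁, h₂, mul_add]
  | tmul l v =>
    induction y using TensorProduct.induction_on with
    | zero => simp
    | add y₁ y₂ h₁ h₂ => simp only [map_add, LinearMap.add_apply, h₁, h₂, mul_add]
    | tmul l' v' =>
      rw [LinearMap.BilinForm.baseChange_tmul, LinearMap.BilinForm.baseChange_tmul, hε, Algebra.smul_def,
        Algebra.smul_def, map_mul]
      ring

/-- **The extension preserves `ψ_L` on pure weights**: for `u ∈ V_{L,s}`, `v ∈ V_{L,t}`,
`ψ_L(E u, E v) = ψ_L(u, v)` — zero on unpaired weights, the contragredient identity on the pairs (with the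
`ε`-symmetry of `ψ` to swap a pair presented as `(ιs₀, s₀)`). [cite: Milne1999LefschetzClasses, §2 Remark 2.2 (p. 647 L48 – p. 648 L7)] -/
theorem baseChange_extend_extend_of_mem (hK : (Algebra.traceForm k K).Nondegenerate)
    (hψ : ∀ (a : K) (x y : V), ψ (a • x) y = ψ x (star a • y))
    (hσ : Injective σ) (hcard : Fintype.card S = finrank k K)
    (hι : ∀ s, σ (ι s) = (σ s).comp star) (hstar : ∀ a, star (star a) = a)
    (hnd : ψ.Nondegenerate) {ε : k} (hε : ∀ x y : V, ψ y x = ε * ψ x y)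
    (hΦ₁ : ∀ s, s ∈ Φ ∨ ι s ∈ Φ) (hΦ₂ : ∀ s ∈ Φ, ι s ∉ Φ)
    (g : ∀ s : Φ, weightSpace k K L V σ s ≃ₗ[L] weightSpace k K L V σ s)
    {s t : S} {u v : L ⊗[k] V} (hu : u ∈ weightSpace k K L V σ s) (hv : v ∈ weightSpace k K L V σ t) :
    LinearMap.BilinForm.baseChange L ψ (extend σ star ι ψ Φ hK hψ hσ hcard hι hstar hnd g u)
        (extend σ star ι ψ Φ hK hψ hσ hcard hι hstar hnd g v) =
      LinearMap.BilinForm.baseChange L ψ u v := by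
  by_cases hst : s = ι t
  · subst hst
    rcases hΦ₁ t with ht | ht
    · -- `v ∈ V_t` with `t ∈ Φ`, `u ∈ V_{ιt}`: swap to the pair `(t, ιt)` with the `ε`-symmetry
      rw [extend_apply_of_mem_ι σ star ι ψ Φ hK hψ hσ hcard hι hstar hnd hΦ₂ g ht hu,
        extend_apply_of_mem σ star ι ψ Φ hK hψ hσ hcard hι hstar hnd hΦ₂ g ht hv,
        baseChange_swap_eq_smul ψ hε (g ⟨t, ht⟩ ⟨v, hv⟩ : L ⊗[k] V), baseChange_swap_eq_smul ψ hε v u]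
      congr 1
      have h := weightPairing_apply_contragredient σ star ι ψ hK hψ hσ hcard hι hstar hnd t (g ⟨t, ht⟩)
        ⟨v, hv⟩ ⟨u, hu⟩
      simpa only [weightPairing_apply] using h
    · -- `ι t ∈ Φ`: `u ∈ V_{ιt}` is moved by `g_{ιt}`, `v ∈ V_t = V_{ι(ιt)}` by its contragredient
      have hv' : v ∈ weightSpace k K L V σ (ι (ι t)) := by rw [ι_ι σ star ι hσ hι hstar]; exact hv
      rw [extend_apply_of_mem σ star ι ψ Φ hK hψ hσ hcard hι hstar hnd hΦ₂ g ht hu,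
        extend_apply_of_mem_ι σ star ι ψ Φ hK hψ hσ hcard hι hstar hnd hΦ₂ g ht hv']
      have h := weightPairing_apply_contragredient σ star ι ψ hK hψ hσ hcard hι hstar hnd (ι t) (g ⟨ι t, ht⟩)
        ⟨u, hu⟩ ⟨v, hv'⟩
      simpa only [weightPairing_apply] using h
  · rw [baseChange_apply_eq_zero_of_ne σ star ι ψ hψ hσ hι hst hu hv,
      baseChange_apply_eq_zero_of_ne σ star ι ψ hψ hσ hι hst
        (extend_apply_mem σ star ι ψ Φ hK hψ hσ hcard hι hstar hnd hΦ₁ hΦ₂ g hu)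
        (extend_apply_mem σ star ι ψ Φ hK hψ hσ hcard hι hstar hnd hΦ₁ hΦ₂ g hv)]

omit [FiniteDimensional k V] in
/-- Two `L`-linear maps on `L ⊗_k V` that agree on every weight space are equal (`Σₜ πₜ = id`).
[cite: Deligne1982HodgeCycles, §4 proof of Prop. 4.4 (re-ed. p. 30, "H¹_B(A) ⊗ ℂ ⥲ ⊕_σ H¹_{B,σ}")] -/
theorem linearMap_eq_of_eqOn_weightSpace (hK : (Algebra.traceForm k K).Nondegenerate)
    (hσ : Injective σ) (hcard : Fintype.card S = finrank k K)
    {M : Type*} [AddCommMonoid M] [Module L M] {f g : (L ⊗[k] V) →ₗ[L] M}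
    (h : ∀ t, ∀ v ∈ weightSpace k K L V σ t, f v = g v) : f = g := by
  refine LinearMap.ext fun w => ?_
  rw [← sum_weightProj_apply k K L V σ hK (Module.finBasis k K) hσ hcard w, map_sum, map_sum]
  exact Finset.sum_congr rfl fun t _ => h t _ (weightProj_apply_mem_weightSpace k K L V σ hK _ t w)

/-- **The extension preserves `ψ_L`**. [cite: Milne1999LefschetzClasses, §2 Remark 2.2 (p. 647 L48 – p. 648 L7)] -/
theorem baseChange_extend_extend (hK : (Algebra.traceForm k K).Nondegenerate)
    (hψ : ∀ (a : K) (x y : V), ψ (a • x) y = ψ x (star a • y))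
    (hσ : Injective σ) (hcard : Fintype.card S = finrank k K)
    (hι : ∀ s, σ (ι s) = (σ s).comp star) (hstar : ∀ a, star (star a) = a)
    (hnd : ψ.Nondegenerate) {ε : k} (hε : ∀ x y : V, ψ y x = ε * ψ x y)
    (hΦ₁ : ∀ s, s ∈ Φ ∨ ι s ∈ Φ) (hΦ₂ : ∀ s ∈ Φ, ι s ∉ Φ)
    (g : ∀ s : Φ, weightSpace k K L V σ s ≃ₗ[L] weightSpace k K L V σ s) (x y : L ⊗[k] V) :
    LinearMap.BilinForm.baseChange L ψ (extend σ star ι ψ Φ hK hψ hσ hcard hι hstar hnd g x)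
        (extend σ star ι ψ Φ hK hψ hσ hcard hι hstar hnd g y) =
      LinearMap.BilinForm.baseChange L ψ x y := by
  set E := extend σ star ι ψ Φ hK hψ hσ hcard hι hstar hnd g with hE
  -- first for `u` of pure weight and arbitrary `y`
  have step : ∀ {s : S} {u : L ⊗[k] V}, u ∈ weightSpace k K L V σ s → ∀ y : L ⊗[k] V,
      LinearMap.BilinForm.baseChange L ψ (E u) (E y) = LinearMap.BilinForm.baseChange L ψ u y := by
    intro s u hu y
    have h := linearMap_eq_of_eqOn_weightSpace σ hK hσ hcard
      (f := (LinearMap.BilinForm.baseChange L ψ (E u)) ∘ₗ E) (g := LinearMap.BilinForm.baseChange L ψ u)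
      fun t v hv => by
        rw [LinearMap.comp_apply]
        exact baseChange_extend_extend_of_mem σ star ι ψ Φ hK hψ hσ hcard hι hstar hnd hε hΦ₁ hΦ₂ g hu hv
    exact LinearMap.congr_fun h y
  have h := linearMap_eq_of_eqOn_weightSpace σ hK hσ hcard
    (f := ((LinearMap.BilinForm.baseChange L ψ).flip (E y)) ∘ₗ E)
    (g := (LinearMap.BilinForm.baseChange L ψ).flip y)
    fun s u hu => by
      rw [LinearMap.comp_apply, LinearMap.BilinForm.flip_apply, LinearMap.BilinForm.flip_apply]
      exact step hu y
  have h' := LinearMap.congr_fun h x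
  rw [LinearMap.comp_apply, LinearMap.BilinForm.flip_apply, LinearMap.BilinForm.flip_apply] at h'
  exact h'

/-- **The extension is injective** (blockwise it is an automorphism). [cite: Milne1999LefschetzClasses, §2 Remark 2.2 (p. 647 L69 – p. 648 L5)] -/
theorem extend_injective (hK : (Algebra.traceForm k K).Nondegenerate)
    (hψ : ∀ (a : K) (x y : V), ψ (a • x) y = ψ x (star a • y))
    (hσ : Injective σ) (hcard : Fintype.card S = finrank k K)
    (hι : ∀ s, σ (ι s) = (σ s).comp star) (hstar : ∀ a, star (star a) = a)
    (hnd : ψ.Nondegenerate) (hΦ₁ : ∀ s, s ∈ Φ ∨ ι s ∈ Φ) (hΦ₂ : ∀ s ∈ Φ, ι s ∉ Φ)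
    (g : ∀ s : Φ, weightSpace k K L V σ s ≃ₗ[L] weightSpace k K L V σ s) :
    Injective (extend σ star ι ψ Φ hK hψ hσ hcard hι hstar hnd g) := by
  rw [injective_iff_map_eq_zero]
  intro x hx
  rw [← sum_weightProj_apply k K L V σ hK (Module.finBasis k K) hσ hcard x]
  refine Finset.sum_eq_zero fun t _ => ?_
  have hxt := weightProj_apply_mem_weightSpace k K L V σ hK (Module.finBasis k K) t x
  have hEt : extend σ star ι ψ Φ hK hψ hσ hcard hι hstar hnd g
      (weightProj k K L V σ hK (Module.finBasis k K) t x) = 0 := by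
    rw [← weightProj_apply_comm_of_comm σ hK
      (extend_comm σ star ι ψ Φ hK hψ hσ hcard hι hstar hnd hΦ₁ hΦ₂ g) t x, hx, map_zero]
  rcases hΦ₁ t with ht | ht
  · rw [extend_apply_of_mem σ star ι ψ Φ hK hψ hσ hcard hι hstar hnd hΦ₂ g ht hxt] at hEt
    have h0 : g ⟨t, ht⟩ ⟨_, hxt⟩ = 0 := Subtype.ext hEt
    rw [LinearEquiv.map_eq_zero_iff] at h0
    exact congrArg Subtype.val h0
  · have hxt' : weightProj k K L V σ hK (Module.finBasis k K) t x ∈ weightSpace k K L V σ (ι (ι t)) := by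
      rw [ι_ι σ star ι hσ hι hstar]; exact hxt
    rw [extend_apply_of_mem_ι σ star ι ψ Φ hK hψ hσ hcard hι hstar hnd hΦ₂ g ht hxt'] at hEt
    have h0 : contragredient σ star ι ψ hK hψ hσ hcard hι hstar hnd (ι t) (g ⟨ι t, ht⟩) ⟨_, hxt'⟩ = 0 :=
      Subtype.ext hEt
    rw [LinearEquiv.map_eq_zero_iff] at h0
    exact congrArg Subtype.val h0

/-- **The extension as an automorphism of `L ⊗_k V`** (injective endomorphism of a finite-dimensional space).
[cite: Milne1999LefschetzClasses, §2 Remark 2.2 (p. 647 L69 – p. 648 L5)] -/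
def extendEquiv (hK : (Algebra.traceForm k K).Nondegenerate)
    (hψ : ∀ (a : K) (x y : V), ψ (a • x) y = ψ x (star a • y))
    (hσ : Injective σ) (hcard : Fintype.card S = finrank k K)
    (hι : ∀ s, σ (ι s) = (σ s).comp star) (hstar : ∀ a, star (star a) = a)
    (hnd : ψ.Nondegenerate) (hΦ₁ : ∀ s, s ∈ Φ ∨ ι s ∈ Φ) (hΦ₂ : ∀ s ∈ Φ, ι s ∉ Φ)
    (g : ∀ s : Φ, weightSpace k K L V σ s ≃ₗ[L] weightSpace k K L V σ s) :
    (L ⊗[k] V) ≃ₗ[L] (L ⊗[k] V) :=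
  LinearEquiv.ofBijective (extend σ star ι ψ Φ hK hψ hσ hcard hι hstar hnd g)
    ⟨extend_injective σ star ι ψ Φ hK hψ hσ hcard hι hstar hnd hΦ₁ hΦ₂ g,
      LinearMap.injective_iff_surjective.1 (extend_injective σ star ι ψ Φ hK hψ hσ hcard hι hstar hnd hΦ₁ hΦ₂ g)⟩

/-- `extendEquiv g x = extend g x`. [cite: Milne1999LefschetzClasses, §2 Remark 2.2 (p. 647)] -/
@[simp] theorem extendEquiv_apply (hK : (Algebra.traceForm k K).Nondegenerate)
    (hψ : ∀ (a : K) (x y : V), ψ (a • x) y = ψ x (star a • y))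
    (hσ : Injective σ) (hcard : Fintype.card S = finrank k K)
    (hι : ∀ s, σ (ι s) = (σ s).comp star) (hstar : ∀ a, star (star a) = a)
    (hnd : ψ.Nondegenerate) (hΦ₁ : ∀ s, s ∈ Φ ∨ ι s ∈ Φ) (hΦ₂ : ∀ s ∈ Φ, ι s ∉ Φ)
    (g : ∀ s : Φ, weightSpace k K L V σ s ≃ₗ[L] weightSpace k K L V σ s) (x : L ⊗[k] V) :
    extendEquiv σ star ι ψ Φ hK hψ hσ hcard hι hstar hnd hΦ₁ hΦ₂ g x =
      extend σ star ι ψ Φ hK hψ hσ hcard hι hstar hnd g x :=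
  rfl

/-- **The extension lies in `U(φ)(L)`** when `ψ` is `ε`-symmetric (Milne: skew-symmetric `e_D`).
[cite: Milne1999LefschetzClasses, §2 Remark 2.2 (p. 647 L69 – p. 648 L7)] -/
theorem extendEquiv_mem (hK : (Algebra.traceForm k K).Nondegenerate)
    (hψ : ∀ (a : K) (x y : V), ψ (a • x) y = ψ x (star a • y))
    (hσ : Injective σ) (hcard : Fintype.card S = finrank k K)
    (hι : ∀ s, σ (ι s) = (σ s).comp star) (hstar : ∀ a, star (star a) = a)
    (hnd : ψ.Nondegenerate) {ε : k} (hε : ∀ x y : V, ψ y x = ε * ψ x y)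
    (hΦ₁ : ∀ s, s ∈ Φ ∨ ι s ∈ Φ) (hΦ₂ : ∀ s ∈ Φ, ι s ∉ Φ)
    (g : ∀ s : Φ, weightSpace k K L V σ s ≃ₗ[L] weightSpace k K L V σ s) :
    extendEquiv σ star ι ψ Φ hK hψ hσ hcard hι hstar hnd hΦ₁ hΦ₂ g ∈ formUnitaryGroup K L ψ :=
  ⟨extend_comm σ star ι ψ Φ hK hψ hσ hcard hι hstar hnd hΦ₁ hΦ₂ g,
    baseChange_extend_extend σ star ι ψ Φ hK hψ hσ hcard hι hstar hnd hε hΦ₁ hΦ₂ g⟩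

/-- **`(⊕ (g_s ⊕ ᵗg_s⁻¹))|V_{L,s} = g_s`**: restriction after extension is the identity.
[cite: Milne1999LefschetzClasses, §2 Remark 2.2 (p. 647 L69 – p. 648 L5)] -/
theorem restrictHom_extendEquiv (hK : (Algebra.traceForm k K).Nondegenerate)
    (hψ : ∀ (a : K) (x y : V), ψ (a • x) y = ψ x (star a • y))
    (hσ : Injective σ) (hcard : Fintype.card S = finrank k K)
    (hι : ∀ s, σ (ι s) = (σ s).comp star) (hstar : ∀ a, star (star a) = a)
    (hnd : ψ.Nondegenerate) {ε : k} (hε : ∀ x y : V, ψ y x = ε * ψ x y)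
    (hΦ₁ : ∀ s, s ∈ Φ ∨ ι s ∈ Φ) (hΦ₂ : ∀ s ∈ Φ, ι s ∉ Φ)
    (g : ∀ s : Φ, weightSpace k K L V σ s ≃ₗ[L] weightSpace k K L V σ s) (s : Φ) :
    restrictHom ψ σ (s : S) ⟨extendEquiv σ star ι ψ Φ hK hψ hσ hcard hι hstar hnd hΦ₁ hΦ₂ g,
      extendEquiv_mem σ star ι ψ Φ hK hψ hσ hcard hι hstar hnd hε hΦ₁ hΦ₂ g⟩ = g s := by
  refine LinearEquiv.ext fun x => Subtype.ext ?_
  rw [coe_restrictHom_apply]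
  exact extend_apply_of_mem σ star ι ψ Φ hK hψ hσ hcard hι hstar hnd hΦ₂ g s.2 x.2

/-! ## §5 Milne's isomorphism `α ↦ α|V₁ : U(φ)_Ω ⥲ GL(V₁)` — for any set `Φ` of representatives of the pairs -/

/-- **`U(φ)(L) ≃* ∏_{s ∈ Φ} GL(V_{L,s})` by `α ↦ (α|V_{L,s})_{s ∈ Φ}`**, for a (skew-, or `ε`-)symmetric
non-degenerate `ψ` Hermitian for `†`, an étale `k′` split by `L` and a set `Φ` of representatives of the
(free) `ι`-orbits `{s, ιs}` — Milne's Remark 2.2 (`[k′ : k] = 2`, `Φ = {σ₁}`: "`α ↦ α|V₁ : U(φ)_Ω → GL(V₁)` is an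
isomorphism") and its use for type IV, p. 651 ("`S(A)_{k^al} = ∏_σ S_σ`, `S_σ ≈ GL`"): the inverse extends a family
of blocks by their contragredients. [cite: Milne1999LefschetzClasses, §2 Remark 2.2 (p. 647 L69 – p. 648 L5) and p. 651 L72–L81 ("S(A)_{/k^al} = ∏ S_σ where S_σ ≈ Aut_{M_d(k^al)}(V₁) ≈ GL_{fg/d}(k^al)")] -/
def formUnitaryGroupEquiv (hK : (Algebra.traceForm k K).Nondegenerate)
    (hψ : ∀ (a : K) (x y : V), ψ (a • x) y = ψ x (star a • y))
    (hσ : Injective σ) (hcard : Fintype.card S = finrank k K)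
    (hι : ∀ s, σ (ι s) = (σ s).comp star) (hstar : ∀ a, star (star a) = a)
    (hnd : ψ.Nondegenerate) {ε : k} (hε : ∀ x y : V, ψ y x = ε * ψ x y)
    (hΦ₁ : ∀ s, s ∈ Φ ∨ ι s ∈ Φ) (hΦ₂ : ∀ s ∈ Φ, ι s ∉ Φ) :
    formUnitaryGroup K L ψ ≃* (∀ s : Φ, weightSpace k K L V σ s ≃ₗ[L] weightSpace k K L V σ s) where
  toFun γ s := restrictHom ψ σ (s : S) γ
  invFun g := ⟨extendEquiv σ star ι ψ Φ hK hψ hσ hcard hι hstar hnd hΦ₁ hΦ₂ g,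
    extendEquiv_mem σ star ι ψ Φ hK hψ hσ hcard hι hstar hnd hε hΦ₁ hΦ₂ g⟩
  left_inv γ := restrictHom_injective_of_cover ψ σ ι star hK hψ hσ hcard hι hstar hnd Φ hΦ₁
    fun s hs => restrictHom_extendEquiv σ star ι ψ Φ hK hψ hσ hcard hι hstar hnd hε hΦ₁ hΦ₂
      (fun t => restrictHom ψ σ (t : S) γ) ⟨s, hs⟩
  right_inv g := funext fun s =>
    restrictHom_extendEquiv σ star ι ψ Φ hK hψ hσ hcard hι hstar hnd hε hΦ₁ hΦ₂ g s
  map_mul' γ δ := funext fun s => map_mul (restrictHom ψ σ (s : S)) γ δ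

/-- The isomorphism IS restriction: `formUnitaryGroupEquiv γ s = γ|V_{L,s}`. [cite: Milne1999LefschetzClasses, §2 Remark 2.2 (p. 647 L69 – p. 648 L5)] -/
@[simp] theorem formUnitaryGroupEquiv_apply (hK : (Algebra.traceForm k K).Nondegenerate)
    (hψ : ∀ (a : K) (x y : V), ψ (a • x) y = ψ x (star a • y))
    (hσ : Injective σ) (hcard : Fintype.card S = finrank k K)
    (hι : ∀ s, σ (ι s) = (σ s).comp star) (hstar : ∀ a, star (star a) = a)
    (hnd : ψ.Nondegenerate) {ε : k} (hε : ∀ x y : V, ψ y x = ε * ψ x y)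
    (hΦ₁ : ∀ s, s ∈ Φ ∨ ι s ∈ Φ) (hΦ₂ : ∀ s ∈ Φ, ι s ∉ Φ) (γ : formUnitaryGroup K L ψ) (s : Φ) :
    formUnitaryGroupEquiv σ star ι ψ Φ hK hψ hσ hcard hι hstar hnd hε hΦ₁ hΦ₂ γ s = restrictHom ψ σ (s : S) γ :=
  rfl

/-- **Surjectivity of `α ↦ (α|V_{L,s})_{s ∈ Φ}`, unbundled**: every family of automorphisms of the `V_{L,s}`,
`s ∈ Φ`, is the family of blocks of a (unique) element of `U(φ)(L)`. [cite: Milne1999LefschetzClasses, §2 Remark 2.2 (p. 647 L69 – p. 648 L5, "is an isomorphism")] -/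
theorem exists_unique_restrictHom_eq (hK : (Algebra.traceForm k K).Nondegenerate)
    (hψ : ∀ (a : K) (x y : V), ψ (a • x) y = ψ x (star a • y))
    (hσ : Injective σ) (hcard : Fintype.card S = finrank k K)
    (hι : ∀ s, σ (ι s) = (σ s).comp star) (hstar : ∀ a, star (star a) = a)
    (hnd : ψ.Nondegenerate) {ε : k} (hε : ∀ x y : V, ψ y x = ε * ψ x y)
    (hΦ₁ : ∀ s, s ∈ Φ ∨ ι s ∈ Φ) (hΦ₂ : ∀ s ∈ Φ, ι s ∉ Φ)
    (g : ∀ s : Φ, weightSpace k K L V σ s ≃ₗ[L] weightSpace k K L V σ s) :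
    ∃! γ : formUnitaryGroup K L ψ, ∀ s : Φ, restrictHom ψ σ (s : S) γ = g s :=
  ⟨(formUnitaryGroupEquiv σ star ι ψ Φ hK hψ hσ hcard hι hstar hnd hε hΦ₁ hΦ₂).symm g,
    fun s => congr_fun ((formUnitaryGroupEquiv σ star ι ψ Φ hK hψ hσ hcard hι hstar hnd hε hΦ₁ hΦ₂).apply_symm_apply g) s,
    fun _ hγ => by
      rw [MulEquiv.eq_symm_apply]
      exact funext hγ⟩

/-- **Milne's Remark 2.2 as printed (`[k′ : k] = 2`)**: for a quadratic étale `k′` with its non-trivial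
involution, two weights `s₁ ≠ s₂ = ι s₁`, "the map `α ↦ α|V₁ : U(φ)_Ω → GL(V₁)` is an isomorphism".
[cite: Milne1999LefschetzClasses, §2 Remark 2.2 (p. 647 L48 – p. 648 L7)] -/
def formUnitaryGroupEquivOfPair (hK : (Algebra.traceForm k K).Nondegenerate)
    (hψ : ∀ (a : K) (x y : V), ψ (a • x) y = ψ x (star a • y))
    (hσ : Injective σ) (hcard : Fintype.card S = finrank k K)
    (hι : ∀ s, σ (ι s) = (σ s).comp star) (hstar : ∀ a, star (star a) = a)
    (hnd : ψ.Nondegenerate) {ε : k} (hε : ∀ x y : V, ψ y x = ε * ψ x y)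
    (s₁ : S) (hs₁ : ι s₁ ≠ s₁) (hS : ∀ s, s = s₁ ∨ s = ι s₁) :
    formUnitaryGroup K L ψ ≃* (weightSpace k K L V σ s₁ ≃ₗ[L] weightSpace k K L V σ s₁) :=
  have hΦ₁ : ∀ s, s ∈ ({s₁} : Finset S) ∨ ι s ∈ ({s₁} : Finset S) := fun s => by
    rcases hS s with rfl | rfl
    · exact Or.inl (Finset.mem_singleton_self _)
    · exact Or.inr (by rw [ι_ι σ star ι hσ hι hstar]; exact Finset.mem_singleton_self _)
  have hΦ₂ : ∀ s ∈ ({s₁} : Finset S), ι s ∉ ({s₁} : Finset S) := fun s hs h => by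
    rw [Finset.mem_singleton] at hs h
    exact hs₁ (hs ▸ h)
  letI : Unique (({s₁} : Finset S) : Type uS) :=
    ⟨⟨⟨s₁, Finset.mem_singleton_self s₁⟩⟩, fun x => Subtype.ext (Finset.mem_singleton.1 x.2)⟩
  (formUnitaryGroupEquiv σ star ι ψ {s₁} hK hψ hσ hcard hι hstar hnd hε hΦ₁ hΦ₂).trans
    (MulEquiv.piUnique fun s : ({s₁} : Finset S) => weightSpace k K L V σ s ≃ₗ[L] weightSpace k K L V σ s)

/-- `formUnitaryGroupEquivOfPair γ = γ|V₁`. [cite: Milne1999LefschetzClasses, §2 Remark 2.2 (p. 647 L69 – p. 648 L5)] -/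
theorem formUnitaryGroupEquivOfPair_apply (hK : (Algebra.traceForm k K).Nondegenerate)
    (hψ : ∀ (a : K) (x y : V), ψ (a • x) y = ψ x (star a • y))
    (hσ : Injective σ) (hcard : Fintype.card S = finrank k K)
    (hι : ∀ s, σ (ι s) = (σ s).comp star) (hstar : ∀ a, star (star a) = a)
    (hnd : ψ.Nondegenerate) {ε : k} (hε : ∀ x y : V, ψ y x = ε * ψ x y)
    (s₁ : S) (hs₁ : ι s₁ ≠ s₁) (hS : ∀ s, s = s₁ ∨ s = ι s₁) (γ : formUnitaryGroup K L ψ) :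
    formUnitaryGroupEquivOfPair σ star ι ψ hK hψ hσ hcard hι hstar hnd hε s₁ hs₁ hS γ = restrictHom ψ σ s₁ γ :=
  rfl

end Extension



end Literature.AlgebraicGeometry.Deligne1982
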